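import Literature.Topology.Immersions.WrinkledEmbeddingsRoundCollar
import Literature.Topology.FourManifolds.DehnSurgeryTubularNbhdProofs
import Literature.Topology.Immersions.HypersurfaceNormalField
import HarnessLib

/-!
# Eliashberg–Mishachev double folds over a round collar: the local model (proved pieces)

Topic `Literature/Topology/Immersions`; companion of `WrinkledEmbeddingsRoundCollar.lean`, whose
named fact `Literature.Topology.Immersions.EliashbergMishachev2009_doubleFolds_of_hasTransversalRotation`
(Eliashberg–Mishachev, *Wrinkled embeddings* (2009), Thm. 3.2 in the double-fold form of the final
Remark of §3.2, relative, `C⁰`-small, for a hypersurface of `ℝ⁵` and the vertical line foliation)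
packages the conclusion "the only tangencies of the new embedding to the vertical foliation are
`k` SPHERICAL DOUBLE FOLDS" (loc. cit. §2.10) as: charts `e j : ℝ⁴ ↪ M` in which the two fold
spheres are the round spheres of radii `1, 2` (`doubleFoldSpheres`), the shadow
`shadowProj ∘ ι` having a Whitney fold (`IsWhitneyFoldAt`, the intrinsic Whitney–Thom condition
of loc. cit. §3.3) at each of their points and injective differential everywhere else.

This file PROVES the pieces of the final assembly of that fact which concern the LOCAL MODEL of a
packaged double fold — the map implanted, in the printed proof, by the goffering of Lemma 2.7
followed by the cusp surgery of Props. 2.11–2.12 and the `ℱ`-regularization of Lemma 3.3: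

* §1 `doubleFoldModel : ℝ⁴ → ℝ⁴`, `P x = (3‖x‖⁴ - 25‖x‖² + 60) x`, the RADIAL PLEAT: its radial
  profile `ρ(r) = 3r⁵ - 25r³ + 60r` has `ρ'(r) = 15(r² - 1)(r² - 4)`, so `P` folds exactly along
  the spheres `r = 1, 2` and is an immersion elsewhere (the tangential eigenvalue
  `3s² - 25s + 60`, `s = r²`, never vanishes).  Proved: `hasFDerivAt_doubleFoldModel`,
  `injective_fderiv_doubleFoldModel` (off `doubleFoldSpheres`), `doubleFoldModelDeriv_self` and
  `isWhitneyFoldAt_doubleFoldModel` (on `doubleFoldSpheres`: kernel `= ℝ u`, intrinsic second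
  derivative `D²P(u)[u,u] = 2‖u‖²·15(2‖u‖²-5) u` (`fderiv_doubleFoldModelDeriv_self`) is radial,
  while every value of `dP(u)` is orthogonal to `u`), `not_injective_fderiv_doubleFoldModel`.
* §2 `doubleFoldLift : ℝ⁴ → ℝ⁵`, `Q x = (P x, ‖x‖²)`: an EMBEDDED hypersurface piece whose shadow
  is `P` (`shadowProj_comp_doubleFoldLift`); `Q` is a `C^∞` injective immersion with the
  continuous left inverse `p ↦ (3p₄² - 25p₄ + 60)⁻¹ · shadowProj p`, hence a smooth embedding
  (`isSmoothEmbedding_doubleFoldLift`), and `exists_doubleFold_localModel` records that the four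
  fold/immersion clauses of the packaged conclusion are realised SIMULTANEOUSLY around a genuine
  double fold (with `M = ℝ⁴`, `e = id`, `k = 1`): the packaging of the fact is satisfiable
  non-vacuously, and the exclusion of the fold spheres from the immersion clause is necessary.

* §3 The Whitney fold predicate `IsWhitneyFoldAt` is LOCAL (`isWhitneyFoldAt_congr_of_eventuallyEq`)
  and INVARIANT under linear automorphisms and translations of the target
  (`isWhitneyFoldAt_comp_continuousLinearEquiv_iff`, `isWhitneyFoldAt_add_const_iff`) and under
  affine automorphisms of the source (`isWhitneyFoldAt_comp_affine_iff`) — the transfers used when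
  the model is implanted in a chart at some centre and scale.
* §4 `injective_mfderiv_shadowProj_comp`: a hypersurface `ι : M⁴ → ℝ⁵` with a normal vector `n`
  at `m` that is not horizontal (`n₄ ≠ 0`) has immersive shadow at `m` — the dictionary between
  the "nowhere horizontal" clause of `HasTransversalRotation`, clause 7 of the fact, and
  transversality to the vertical line foliation (loc. cit. §3.3).

* §5 The round part: under the round-part hypothesis of the fact, `‖ι₁‖ = 1` at heights
  `≤ 1 - δ₁` (`norm_eq_one_of_roundPart`), the position vector is normal
  (`inner_self_mfderiv_eq_zero_of_roundPart`, by differentiating `‖ι₁‖² = 1` on the open set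
  `{h ∘ ι₁ < 1 - δ₁}`), `dι₁(m)` maps ONTO `(ι₁ m)^⊥` when injective
  (`exists_mfderiv_eq_of_roundPart`, dimension count), every normal vector is a multiple of
  `ι₁ m` and a unit normal is `± ι₁ m` (`eq_or_eq_neg_of_inner_mfderiv_eq_zero_of_roundPart`),
  and the round collar `{0 < h ∘ ι₁ < 1 - δ₁}` is already transversal to the vertical foliation
  (`injective_mfderiv_shadowProj_comp_of_roundPart`) — the input "`f` already transversal on
  `𝒪p A`" of the relative form (Remark 2) of Thm. 3.2, and the identification `ν = ± ι₁` on the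
  round part used by the formal datum.

* §6 `isWhitneyFoldAt_comp_iff_of_contDiff`: invariance of the Whitney fold predicate under
  post-composition with a `C²` map whose differential at the image point is invertible (Leibniz
  rule on the kernel vector, `fderiv_fderiv_comp_apply_of_apply_eq_zero`) — reading a pleat
  through a nonlinear chart of the leaf space.
* §7 Radial pleats with a GENERAL `C²` profile `ψ` (`radialMap ψ x = ψ(‖x‖²) x`): differential,
  tangential/radial eigenvalues (`radialFactor ψ`), immersion criterion, kernel and Whitney fold at
  a simple zero of the radial eigenvalue (`isWhitneyFoldAt_radialMap`), and lifts
  `x ↦ (P x, η x)` to `ℝ⁵` (`pad5`, `fderiv_pad5_apply_eq_zero_iff`: the lift is immersive iff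
  `ker dP ∩ ker dη = 0`) — the form in which a double fold with compactly supported profile is
  implanted into a transversal graph.

* §8 `HasTransversalRotation.exists_smooth_rotation` (Part A of the input of the printed proof):
  the formal datum, only assumed continuous, yields a `C^∞` homotopy `Φ : M × ℝ → ℝ⁵` of unit
  vector fields starting at the (automatically smooth) unit normal, constant in time on a smaller
  round region and nowhere horizontal at `t = 1` on the top part (`HypersurfaceNormalField.lean`:
  a continuous unit normal is smooth; relative smooth approximation by unit fields on `M × ℝ`).
* §10 `EliashbergMishachev2009_doubleFolds_of_engine`: the fact FOLLOWS from the engine of the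
  printed proof stated in smooth Gauss-map form on a closed `4`-manifold (Thm. 2.10 relative +
  regularization §2.3 B + round packaging, as an explicit hypothesis — parts B, C of the printed
  proof, not proved in the tree), by §5, §8, the injectivity of the differential of a smooth
  embedding (the tree's `Literature.Topology.FourManifolds.mfderiv_injective_of_isImmersion`)
  and the bookkeeping of the levels `δ₁ < δ₁' < δ_mid < δ`.  This fixes the engine's interface and
  machine-checks all the glue; `engine_conclusion_of_transversal` checks the interface in the
  trivial case (final planes already transversal off `A`: `ι' = ι`, no double folds).

Nothing here is a named fact; everything is proved. The discharge
`EliashbergMishachev2009_doubleFolds_of_hasTransversalRotation_holds` itself needs the whole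
wrinkled-embeddings engine of the source (fine triangulations, holonomic approximation over the
`3`-skeleton, the goffering Lemma 2.7 in parametric form, cusp surgery, regularization) and is NOT
in this file.

## References

* Y. Eliashberg, N. Mishachev, *Wrinkled embeddings*, Contemp. Math. **498** (2009), 207–232,
  §2.10 (spherical double folds), §3.2 Thm. 3.2 and final Remark, §3.3. [EliashbergMishachev2009]
* For the non-parametric hypersurface case used by the fact, loc. cit. §1.4 B also points to
  Y. Eliashberg, *Surgery of singularities of smooth mappings*, Izv. Akad. Nauk SSSR **36** (1972),
  1321–1347 (the original proof for `n = m - 1`), and D. Spring, *Directed embeddings of closed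
  manifolds*, Commun. Contemp. Math. **7** (2005), 707–725 (twofold spherical corners, by convex
  integration) — alternative printed routes to the same statement.
-/

open scoped Manifold ContDiff Topology InnerProductSpace
open Set Function

noncomputable section

namespace Literature.Topology.Immersions

/-- Local notation: `𝔼 n` is the model Euclidean space `EuclideanSpace ℝ (Fin n)`. -/
local notation "𝔼 " n:arg => EuclideanSpace ℝ (Fin n)

/-! ### §1 The radial pleat `P x = (3‖x‖⁴ - 25‖x‖² + 60) • x` -/

/-- The TANGENTIAL factor of the radial pleat as a function of `s = ‖x‖²`:
`φ(s) = 3s² - 25s + 60` (so that `P x = φ(‖x‖²) x`). [folklore] -/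
def dfPhi (s : ℝ) : ℝ := 3 * s ^ 2 - 25 * s + 60

/-- The RADIAL factor of the radial pleat as a function of `s = ‖x‖²`: the derivative of the
radial profile `ρ(r) = r φ(r²)` is `ρ'(r) = φ(r²) + 2r² φ'(r²) = 15(r² - 1)(r² - 4)`, i.e.
`dfRad s = 15 (s - 1)(s - 4)`. [folklore] -/
def dfRad (s : ℝ) : ℝ := 15 * (s - 1) * (s - 4)

/-- `φ > 0` everywhere (discriminant `25² - 4·3·60 < 0`). [folklore] -/
theorem dfPhi_pos (s : ℝ) : 0 < dfPhi s := by
  unfold dfPhi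
  nlinarith [sq_nonneg (s - 25 / 6)]

/-- `φ ≠ 0`. [folklore] -/
theorem dfPhi_ne_zero (s : ℝ) : dfPhi s ≠ 0 := (dfPhi_pos s).ne'

/-- `φ(s) + 2s φ'(s) = dfRad s` (`φ'(s) = 6s - 25`). [folklore] -/
theorem dfPhi_add_eq_dfRad (s : ℝ) : dfPhi s + 2 * (6 * s - 25) * s = dfRad s := by
  unfold dfPhi dfRad
  ring

/-- `dfRad s = 0 ↔ s = 1 ∨ s = 4`. [folklore] -/
theorem dfRad_eq_zero_iff (s : ℝ) : dfRad s = 0 ↔ s = 1 ∨ s = 4 := by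
  unfold dfRad
  constructor
  · intro h
    have h' : (s - 1) * (s - 4) = 0 := by nlinarith [h]
    rcases mul_eq_zero.1 h' with h1 | h4
    · exact Or.inl (by linarith)
    · exact Or.inr (by linarith)
  · rintro (rfl | rfl) <;> ring

/-- **The radial pleat** (local model of a packaged spherical double fold of the shadow):
`P x = (3‖x‖⁴ - 25‖x‖² + 60) x`.  Radial profile `ρ(r) = 3r⁵ - 25r³ + 60r`, increasing on
`[0, 1]`, decreasing on `[1, 2]`, increasing on `[2, ∞)`: three sheets over the shell
`ρ(2) < |y| < ρ(1)`, folded along the round spheres of radii `1` and `2`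
(Eliashberg–Mishachev §2.10: a double fold `S³ × S⁰` bounding the annulus `1 ≤ ‖x‖ ≤ 2`).
[folklore] -/
def doubleFoldModel (x : 𝔼 4) : 𝔼 4 := dfPhi (‖x‖ ^ 2) • x

/-- Unfolding of `doubleFoldModel`. [folklore] -/
theorem doubleFoldModel_apply (x : 𝔼 4) : doubleFoldModel x = dfPhi (‖x‖ ^ 2) • x := rfl

/-- The radial pleat is `C^∞`. [folklore] -/
theorem contDiff_doubleFoldModel : ContDiff ℝ ∞ doubleFoldModel := by
  have h : ContDiff ℝ ∞ fun x : 𝔼 4 => ‖x‖ ^ 2 := contDiff_norm_sq ℝ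
  have h2 : ContDiff ℝ ∞ fun x : 𝔼 4 => dfPhi (‖x‖ ^ 2) := by
    unfold dfPhi
    exact ((contDiff_const.mul (h.pow 2)).sub (contDiff_const.mul h)).add contDiff_const
  exact h2.smul contDiff_id

/-- The derivative of the radial pleat at `x`:
`v ↦ φ(‖x‖²) v + 2 φ'(‖x‖²) ⟪x, v⟫ x`. [folklore] -/
def doubleFoldModelDeriv (x : 𝔼 4) : 𝔼 4 →L[ℝ] 𝔼 4 :=
  dfPhi (‖x‖ ^ 2) • ContinuousLinearMap.id ℝ (𝔼 4) +
    (2 * (6 * ‖x‖ ^ 2 - 25)) • (innerSL ℝ x).smulRight x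

/-- Unfolding of `doubleFoldModelDeriv`. [folklore] -/
theorem doubleFoldModelDeriv_apply (x v : 𝔼 4) :
    doubleFoldModelDeriv x v = dfPhi (‖x‖ ^ 2) • v + (2 * (6 * ‖x‖ ^ 2 - 25) * ⟪x, v⟫_ℝ) • x := by
  simp [doubleFoldModelDeriv, mul_smul]

/-- The scalar factor `x ↦ φ(‖x‖²)` has derivative `(6‖x‖² - 25) · 2⟪x, ·⟫` at `x`. [folklore] -/
theorem hasFDerivAt_dfPhi_norm_sq (x : 𝔼 4) :
    HasFDerivAt (fun y : 𝔼 4 => dfPhi (‖y‖ ^ 2)) ((6 * ‖x‖ ^ 2 - 25) • (2 • innerSL ℝ x)) x := by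
  have h1 : HasFDerivAt (fun y : 𝔼 4 => ‖y‖ ^ 2) (2 • innerSL ℝ x) x :=
    (hasStrictFDerivAt_norm_sq x).hasFDerivAt
  have h2 : HasDerivAt dfPhi (6 * ‖x‖ ^ 2 - 25) (‖x‖ ^ 2) := by
    show HasDerivAt (fun s : ℝ => 3 * s ^ 2 - 25 * s + 60) _ _
    have h := (((hasDerivAt_pow 2 (‖x‖ ^ 2)).const_mul 3).sub
      ((hasDerivAt_id' (‖x‖ ^ 2)).const_mul 25)).add_const 60
    refine h.congr_deriv ?_
    push_cast
    ring
  exact h2.comp_hasFDerivAt x h1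

/-- The radial pleat has derivative `doubleFoldModelDeriv x` at `x`. [folklore] -/
theorem hasFDerivAt_doubleFoldModel (x : 𝔼 4) :
    HasFDerivAt doubleFoldModel (doubleFoldModelDeriv x) x := by
  have h := (hasFDerivAt_dfPhi_norm_sq x).smul (hasFDerivAt_id (𝕜 := ℝ) x)
  refine h.congr_fderiv (ContinuousLinearMap.ext fun v => ?_)
  rw [doubleFoldModelDeriv_apply]
  simp only [add_apply, smul_apply, ContinuousLinearMap.id_apply,
    ContinuousLinearMap.smulRight_apply, innerSL_apply_apply, id_eq, smul_eq_mul, nsmul_eq_mul,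
    Nat.cast_ofNat]
  module

/-- `fderiv` of the radial pleat. [folklore] -/
theorem fderiv_doubleFoldModel (x : 𝔼 4) : fderiv ℝ doubleFoldModel x = doubleFoldModelDeriv x :=
  (hasFDerivAt_doubleFoldModel x).fderiv

/-- Pairing the derivative with the position: `⟪x, dP(x) v⟫ = dfRad(‖x‖²) ⟪x, v⟫` — the radial
eigenvalue of `dP(x)` is `ρ'(‖x‖)`. [folklore] -/
theorem inner_doubleFoldModelDeriv (x v : 𝔼 4) :
    ⟪x, doubleFoldModelDeriv x v⟫_ℝ = dfRad (‖x‖ ^ 2) * ⟪x, v⟫_ℝ := by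
  rw [doubleFoldModelDeriv_apply, inner_add_right, inner_smul_right, inner_smul_right,
    real_inner_self_eq_norm_sq, ← dfPhi_add_eq_dfRad]
  ring

/-- Membership in `doubleFoldSpheres` in terms of `‖u‖²`. [folklore] -/
theorem mem_doubleFoldSpheres_iff (u : 𝔼 4) : u ∈ doubleFoldSpheres ↔ ‖u‖ ^ 2 = 1 ∨ ‖u‖ ^ 2 = 4 := by
  simp only [doubleFoldSpheres, mem_union, mem_sphere_iff_norm, sub_zero]
  have h0 : 0 ≤ ‖u‖ := norm_nonneg u
  constructor
  · rintro (h | h)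
    · left
      rw [h, one_pow]
    · right
      rw [h]
      norm_num
  · rintro (h | h)
    · left
      exact (pow_left_inj₀ h0 zero_le_one two_ne_zero).1 (by rw [h, one_pow])
    · right
      exact (pow_left_inj₀ h0 zero_le_two two_ne_zero).1 (by rw [h]; norm_num)

/-- Membership in `doubleFoldSpheres` is the vanishing of the radial eigenvalue. [folklore] -/
theorem mem_doubleFoldSpheres_iff_dfRad (u : 𝔼 4) : u ∈ doubleFoldSpheres ↔ dfRad (‖u‖ ^ 2) = 0 := by
  rw [mem_doubleFoldSpheres_iff, dfRad_eq_zero_iff]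

/-- **Off the two fold spheres the radial pleat is an immersion.**  If `dP(x) v = 0` then pairing
with `x` gives `ρ'(‖x‖) ⟪x, v⟫ = 0`, so `⟪x, v⟫ = 0` and `φ(‖x‖²) v = 0`. [folklore] -/
theorem injective_doubleFoldModelDeriv {x : 𝔼 4} (hx : x ∉ doubleFoldSpheres) :
    Injective (doubleFoldModelDeriv x) := by
  rw [mem_doubleFoldSpheres_iff_dfRad] at hx
  refine (injective_iff_map_eq_zero _).2 fun v hv => ?_
  have h1 : dfRad (‖x‖ ^ 2) * ⟪x, v⟫_ℝ = 0 := by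
    rw [← inner_doubleFoldModelDeriv, hv, inner_zero_right]
  have h2 : ⟪x, v⟫_ℝ = 0 := (mul_eq_zero.1 h1).resolve_left hx
  rw [doubleFoldModelDeriv_apply, h2, mul_zero, zero_smul, add_zero] at hv
  exact (smul_eq_zero.1 hv).resolve_left (dfPhi_ne_zero _)

/-- Off the fold spheres the Fréchet derivative of the radial pleat is injective. [folklore] -/
theorem injective_fderiv_doubleFoldModel {x : 𝔼 4} (hx : x ∉ doubleFoldSpheres) :
    Injective (fderiv ℝ doubleFoldModel x) := by
  rw [fderiv_doubleFoldModel]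
  exact injective_doubleFoldModelDeriv hx

/-- On the fold spheres the radial direction is in the kernel: `dP(u) u = ρ'(‖u‖) u = 0`.
[folklore] -/
theorem doubleFoldModelDeriv_self {u : 𝔼 4} (hu : u ∈ doubleFoldSpheres) :
    doubleFoldModelDeriv u u = 0 := by
  rw [mem_doubleFoldSpheres_iff_dfRad] at hu
  rw [doubleFoldModelDeriv_apply, real_inner_self_eq_norm_sq, ← add_smul, dfPhi_add_eq_dfRad, hu,
    zero_smul]

/-- On the fold spheres the differential of the radial pleat is NOT injective. [folklore] -/
theorem not_injective_fderiv_doubleFoldModel {u : 𝔼 4} (hu : u ∈ doubleFoldSpheres) :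
    ¬ Injective (fderiv ℝ doubleFoldModel u) := by
  intro h
  have hu0 : u ≠ 0 := by
    rintro rfl
    rw [mem_doubleFoldSpheres_iff, norm_zero] at hu
    norm_num at hu
  rw [fderiv_doubleFoldModel] at h
  exact hu0 (h (by rw [doubleFoldModelDeriv_self hu, map_zero]))

/-- Along the radial line through `u` the field `w ↦ dP(w) u` is explicit:
`dP((1 + t) u) u = dfRad((1 + t)² ‖u‖²) u`. [folklore] -/
theorem doubleFoldModelDeriv_line (u : 𝔼 4) (t : ℝ) :
    doubleFoldModelDeriv (u + t • u) u = dfRad ((1 + t) ^ 2 * ‖u‖ ^ 2) • u := by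
  have hline : u + t • u = (1 + t) • u := by rw [add_smul, one_smul]
  rw [hline, doubleFoldModelDeriv_apply, norm_smul, real_inner_smul_left, real_inner_self_eq_norm_sq,
    mul_pow, Real.norm_eq_abs, sq_abs, smul_smul, ← add_smul, ← dfPhi_add_eq_dfRad]
  congr 1
  ring

/-- The intrinsic second derivative of the radial pleat along the radial kernel direction:
`D(w ↦ dP(w) u)(u)[u] = 2‖u‖² · dfRad'(‖u‖²) · u` with `dfRad'(s) = 15(2s - 5)`. [folklore] -/
theorem fderiv_doubleFoldModelDeriv_self (u : 𝔼 4) :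
    fderiv ℝ (fun w => fderiv ℝ doubleFoldModel w u) u u =
      (15 * (2 * ‖u‖ ^ 2 - 5) * (2 * ‖u‖ ^ 2)) • u := by
  -- the field `F w = dP(w) u` is an explicit polynomial map
  have hFeq : (fun w => fderiv ℝ doubleFoldModel w u) =
      fun w => dfPhi (‖w‖ ^ 2) • u + (2 * (6 * ‖w‖ ^ 2 - 25) * ⟪w, u⟫_ℝ) • w := by
    funext w
    rw [fderiv_doubleFoldModel, doubleFoldModelDeriv_apply]
  rw [hFeq]
  set F : 𝔼 4 → 𝔼 4 := fun w => dfPhi (‖w‖ ^ 2) • u + (2 * (6 * ‖w‖ ^ 2 - 25) * ⟪w, u⟫_ℝ) • w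
    with hF
  -- `F` is differentiable
  have hn : Differentiable ℝ fun w : 𝔼 4 => ‖w‖ ^ 2 :=
    (contDiff_norm_sq ℝ : ContDiff ℝ 1 fun w : 𝔼 4 => ‖w‖ ^ 2).differentiable one_ne_zero
  have hphi : Differentiable ℝ fun w : 𝔼 4 => dfPhi (‖w‖ ^ 2) := by
    show Differentiable ℝ fun w : 𝔼 4 => 3 * (‖w‖ ^ 2) ^ 2 - 25 * ‖w‖ ^ 2 + 60
    exact (((differentiable_const _).mul (hn.pow 2)).sub ((differentiable_const _).mul hn)).add
      (differentiable_const _)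
  have hinner : Differentiable ℝ fun w : 𝔼 4 => ⟪w, u⟫_ℝ :=
    differentiable_id.inner ℝ (differentiable_const u)
  have hg : Differentiable ℝ fun w : 𝔼 4 => 2 * (6 * ‖w‖ ^ 2 - 25) * ⟪w, u⟫_ℝ :=
    ((differentiable_const _).mul (((differentiable_const _).mul hn).sub
      (differentiable_const _))).mul hinner
  have hFd : Differentiable ℝ F := (hphi.smul_const u).add (hg.smul differentiable_id)
  -- restrict to the radial line `t ↦ u + t u`
  have hl : HasDerivAt (fun t : ℝ => u + t • u) u 0 := by
    simpa using ((hasDerivAt_id' (0 : ℝ)).smul_const u).const_add u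
  have hFd' : HasFDerivAt F (fderiv ℝ F u) (u + (0 : ℝ) • u) := by
    rw [zero_smul, add_zero]
    exact (hFd u).hasFDerivAt
  have hcomp : HasDerivAt (fun t : ℝ => F (u + t • u)) (fderiv ℝ F u u) 0 := by
    have h := hFd'.comp_hasDerivAt (0 : ℝ) hl
    rw [Function.comp_def] at h
    exact h
  -- along that line `F` is `dfRad((1+t)²‖u‖²) u`
  have hline : (fun t : ℝ => F (u + t • u)) = fun t => dfRad ((1 + t) ^ 2 * ‖u‖ ^ 2) • u := by
    funext t
    rw [hF, ← doubleFoldModelDeriv_line u t, doubleFoldModelDeriv_apply]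
  rw [hline] at hcomp
  -- whose derivative at `0` is explicit
  have hrad : ∀ s : ℝ, HasDerivAt dfRad (15 * (2 * s - 5)) s := by
    intro s
    show HasDerivAt (fun y : ℝ => 15 * (y - 1) * (y - 4)) _ _
    exact ((((hasDerivAt_id' s).sub_const 1).const_mul 15).mul
      ((hasDerivAt_id' s).sub_const 4)).congr_deriv (by ring)
  have h1 : HasDerivAt (fun t : ℝ => (1 + t) ^ 2 * ‖u‖ ^ 2) (2 * ‖u‖ ^ 2) 0 :=
    ((((hasDerivAt_id' (0 : ℝ)).const_add 1).pow 2).mul_const (‖u‖ ^ 2)).congr_deriv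
      (by norm_num)
  have h2 : HasDerivAt dfRad (15 * (2 * ‖u‖ ^ 2 - 5)) ((1 + (0 : ℝ)) ^ 2 * ‖u‖ ^ 2) :=
    (hrad _).congr_deriv (by ring)
  have hexp : HasDerivAt (fun t : ℝ => dfRad ((1 + t) ^ 2 * ‖u‖ ^ 2) • u)
      ((15 * (2 * ‖u‖ ^ 2 - 5) * (2 * ‖u‖ ^ 2)) • u) 0 := by
    have h := (h2.comp 0 h1).smul_const u
    rw [Function.comp_def] at h
    exact h
  exact hcomp.unique hexp

/-- **The radial pleat has a Whitney fold at every point of the two fold spheres** (intrinsic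
form `IsWhitneyFoldAt`): the kernel vector is `u` itself, and the intrinsic second derivative
`c u` (`c = 30‖u‖²·15(2‖u‖² - 5) ≠ 0` for `‖u‖² ∈ {1, 4}`) is radial, while every value
`dP(u) v` is orthogonal to `u` (`⟪u, dP(u) v⟫ = ρ'(‖u‖)⟪u, v⟫ = 0`). [folklore] -/
theorem isWhitneyFoldAt_doubleFoldModel {u : 𝔼 4} (hu : u ∈ doubleFoldSpheres) :
    IsWhitneyFoldAt doubleFoldModel u := by
  have hrad : dfRad (‖u‖ ^ 2) = 0 := (mem_doubleFoldSpheres_iff_dfRad u).1 hu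
  have hsq : ‖u‖ ^ 2 = 1 ∨ ‖u‖ ^ 2 = 4 := (mem_doubleFoldSpheres_iff u).1 hu
  have hu0 : u ≠ 0 := by
    rintro rfl
    rw [norm_zero] at hsq
    norm_num at hsq
  have hc0 : (15 * (2 * ‖u‖ ^ 2 - 5) * (2 * ‖u‖ ^ 2)) ≠ 0 := by
    rcases hsq with h | h <;> rw [h] <;> norm_num
  refine ⟨u, hu0, ?_, ?_⟩
  · rw [fderiv_doubleFoldModel, doubleFoldModelDeriv_self hu]
  · rw [fderiv_doubleFoldModelDeriv_self, fderiv_doubleFoldModel]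
    rintro ⟨v, hv⟩
    have hv' : doubleFoldModelDeriv u v = (15 * (2 * ‖u‖ ^ 2 - 5) * (2 * ‖u‖ ^ 2)) • u := hv
    have h1 : ⟪u, doubleFoldModelDeriv u v⟫_ℝ = 0 := by
      rw [inner_doubleFoldModelDeriv, hrad, zero_mul]
    rw [hv', inner_smul_right, real_inner_self_eq_norm_sq] at h1
    rcases mul_eq_zero.1 h1 with h | h
    · exact hc0 h
    · exact hu0 (by simpa using h)

/-! ### §2 The embedded lift `Q x = (P x, ‖x‖²)` -/

/-- **The embedded radial pleat** `Q : ℝ⁴ → ℝ⁵`, `Q x = (P x, ‖x‖²)`: a hypersurface piece of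
`ℝ⁵` whose vertical shadow is the radial pleat `P` and whose height `‖x‖²` separates the three
sheets of `P` (the local picture of a spherical double fold of an embedding with respect to the
vertical line foliation, Eliashberg–Mishachev §2.10 with §3.3, after regularization). [folklore] -/
def doubleFoldLift (x : 𝔼 4) : 𝔼 5 :=
  WithLp.toLp 2 ![doubleFoldModel x 0, doubleFoldModel x 1, doubleFoldModel x 2,
    doubleFoldModel x 3, ‖x‖ ^ 2]

/-- The shadow of the embedded pleat is the radial pleat. [folklore] -/
theorem shadowProj_doubleFoldLift (x : 𝔼 4) : shadowProj (doubleFoldLift x) = doubleFoldModel x := by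
  ext i
  fin_cases i <;> simp [shadowProj, doubleFoldLift]

/-- The shadow of the embedded pleat is the radial pleat (as functions). [folklore] -/
theorem shadowProj_comp_doubleFoldLift : shadowProj ∘ doubleFoldLift = doubleFoldModel :=
  funext shadowProj_doubleFoldLift

/-- The height of the embedded pleat is `‖x‖²`. [folklore] -/
theorem doubleFoldLift_apply_four (x : 𝔼 4) : doubleFoldLift x 4 = ‖x‖ ^ 2 := by
  simp [doubleFoldLift]

/-- The embedded pleat is `C^∞`. [folklore] -/
theorem contDiff_doubleFoldLift : ContDiff ℝ ∞ doubleFoldLift := by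
  rw [contDiff_euclidean]
  have hP := contDiff_euclidean.1 contDiff_doubleFoldModel
  have hn : ContDiff ℝ ∞ fun x : 𝔼 4 => ‖x‖ ^ 2 := contDiff_norm_sq ℝ
  intro i
  fin_cases i
  · simpa [doubleFoldLift] using hP 0
  · simpa [doubleFoldLift] using hP 1
  · simpa [doubleFoldLift] using hP 2
  · simpa [doubleFoldLift] using hP 3
  · simpa [doubleFoldLift] using hn

/-- The continuous LEFT INVERSE of the embedded pleat: `p ↦ φ(p₄)⁻¹ · shadowProj p`
(`φ(‖x‖²) ≠ 0`). [folklore] -/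
def doubleFoldLiftInv (p : 𝔼 5) : 𝔼 4 := (dfPhi (p 4))⁻¹ • shadowProj p

/-- `doubleFoldLiftInv ∘ doubleFoldLift = id`. [folklore] -/
theorem leftInverse_doubleFoldLiftInv : LeftInverse doubleFoldLiftInv doubleFoldLift := by
  intro x
  rw [doubleFoldLiftInv, doubleFoldLift_apply_four, shadowProj_doubleFoldLift, doubleFoldModel_apply,
    smul_smul, inv_mul_cancel₀ (dfPhi_ne_zero _), one_smul]

/-- The left inverse is continuous. [folklore] -/
theorem continuous_doubleFoldLiftInv : Continuous doubleFoldLiftInv := by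
  have h4 : Continuous fun p : 𝔼 5 => dfPhi (p 4) := by
    unfold dfPhi
    fun_prop
  exact (h4.inv₀ fun p => dfPhi_ne_zero _).smul shadowProjL.continuous

/-- The embedded pleat is injective. [folklore] -/
theorem injective_doubleFoldLift : Injective doubleFoldLift :=
  leftInverse_doubleFoldLiftInv.injective

/-- The embedded pleat is a topological embedding (it has a continuous left inverse). [folklore] -/
theorem isEmbedding_doubleFoldLift : Topology.IsEmbedding doubleFoldLift :=
  leftInverse_doubleFoldLiftInv.isEmbedding continuous_doubleFoldLiftInv
    contDiff_doubleFoldLift.continuous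

/-- The shadow component of the differential of the embedded pleat is `dP`. [folklore] -/
theorem shadowProjL_comp_fderiv_doubleFoldLift (x : 𝔼 4) :
    (shadowProjL : 𝔼 5 →L[ℝ] 𝔼 4).comp (fderiv ℝ doubleFoldLift x) = doubleFoldModelDeriv x := by
  have hQ : DifferentiableAt ℝ doubleFoldLift x := contDiff_doubleFoldLift.differentiable (by simp) x
  have h := shadowProjL.hasFDerivAt.comp x hQ.hasFDerivAt
  have heq : (shadowProjL : 𝔼 5 → 𝔼 4) ∘ doubleFoldLift = doubleFoldModel :=
    shadowProj_comp_doubleFoldLift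
  rw [heq] at h
  exact h.unique (hasFDerivAt_doubleFoldModel x)

/-- The height component of the differential of the embedded pleat is `2⟪x, ·⟫`. [folklore] -/
theorem proj_four_fderiv_doubleFoldLift (x v : 𝔼 4) :
    (fderiv ℝ doubleFoldLift x v) 4 = 2 * ⟪x, v⟫_ℝ := by
  have hQ : DifferentiableAt ℝ doubleFoldLift x := contDiff_doubleFoldLift.differentiable (by simp) x
  have h := (EuclideanSpace.proj (4 : Fin 5) : 𝔼 5 →L[ℝ] ℝ).hasFDerivAt.comp x hQ.hasFDerivAt
  have heq : ((EuclideanSpace.proj (4 : Fin 5) : 𝔼 5 →L[ℝ] ℝ) : 𝔼 5 → ℝ) ∘ doubleFoldLift =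
      fun y : 𝔼 4 => ‖y‖ ^ 2 := by
    funext y
    simp [doubleFoldLift_apply_four]
  rw [heq] at h
  have h' := h.unique (hasStrictFDerivAt_norm_sq x).hasFDerivAt
  have := congrArg (fun L : 𝔼 4 →L[ℝ] ℝ => L v) h'
  simpa using this

/-- **The embedded pleat is an immersion** — at every point, fold spheres included: a vector
killed by `dQ(x)` has `dP(x) v = 0` and `⟪x, v⟫ = 0`, hence `φ(‖x‖²) v = 0`. [folklore] -/
theorem injective_fderiv_doubleFoldLift (x : 𝔼 4) : Injective (fderiv ℝ doubleFoldLift x) := by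
  refine (injective_iff_map_eq_zero _).2 fun v hv => ?_
  have h1 : doubleFoldModelDeriv x v = 0 := by
    rw [← shadowProjL_comp_fderiv_doubleFoldLift, ContinuousLinearMap.comp_apply, hv, map_zero]
  have h2 : ⟪x, v⟫_ℝ = 0 := by
    have := proj_four_fderiv_doubleFoldLift x v
    rw [hv] at this
    simpa using this.symm
  rw [doubleFoldModelDeriv_apply, h2, mul_zero, zero_smul, add_zero] at h1
  exact (smul_eq_zero.1 h1).resolve_left (dfPhi_ne_zero _)

/-- **The embedded pleat is a smooth embedding of `ℝ⁴` into `ℝ⁵`** (Mathlib's chart sense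
`Manifold.IsSmoothEmbedding`: an immersion by the tree's immersion criterion, and a topological
embedding by its continuous left inverse). [folklore] -/
theorem isSmoothEmbedding_doubleFoldLift :
    Manifold.IsSmoothEmbedding (𝓡 4) (𝓡 5) ∞ doubleFoldLift := by
  refine ⟨Literature.Topology.FourManifolds.isImmersion_of_injective_mfderiv
    (contMDiff_iff_contDiff.2 contDiff_doubleFoldLift) (by simp) fun x => ?_,
    isEmbedding_doubleFoldLift⟩
  rw [mfderiv_eq_fderiv]
  exact injective_fderiv_doubleFoldLift x

/-- Off the fold spheres the shadow of the embedded pleat is an immersion. [folklore] -/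
theorem injective_mfderiv_shadowProj_doubleFoldLift {u : 𝔼 4} (hu : u ∉ doubleFoldSpheres) :
    Injective (mfderiv (𝓡 4) (𝓡 4) (shadowProj ∘ doubleFoldLift) u) := by
  rw [shadowProj_comp_doubleFoldLift, mfderiv_eq_fderiv]
  exact injective_fderiv_doubleFoldModel hu

/-- On the fold spheres the shadow of the embedded pleat is NOT an immersion. [folklore] -/
theorem not_injective_mfderiv_shadowProj_doubleFoldLift {u : 𝔼 4} (hu : u ∈ doubleFoldSpheres) :
    ¬ Injective (mfderiv (𝓡 4) (𝓡 4) (shadowProj ∘ doubleFoldLift) u) := by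
  rw [shadowProj_comp_doubleFoldLift, mfderiv_eq_fderiv]
  exact not_injective_fderiv_doubleFoldModel hu

/-- On the fold spheres the shadow of the embedded pleat has a Whitney fold. [folklore] -/
theorem isWhitneyFoldAt_shadowProj_doubleFoldLift {u : 𝔼 4} (hu : u ∈ doubleFoldSpheres) :
    IsWhitneyFoldAt (shadowProj ∘ doubleFoldLift) u := by
  rw [shadowProj_comp_doubleFoldLift]
  exact isWhitneyFoldAt_doubleFoldModel hu

/-- **The packaged double fold is realised by an embedded hypersurface piece** (non-vacuity of
clauses 5–8 of `EliashbergMishachev2009_doubleFolds_of_hasTransversalRotation` around a GENUINE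
double fold, i.e. with `k = 1`, `M = ℝ⁴`, `e = id`): there is a smooth embedding `Q : ℝ⁴ ↪ ℝ⁵`
whose shadow is an immersion exactly off `doubleFoldSpheres`, and has a Whitney fold at each point
of `doubleFoldSpheres`.  This is the local model which the printed proof implants (Lemma 2.7's
goffering, the cusp surgery of Props. 2.11–2.12 and the `ℱ`-regularization of Lemma 3.3), here in
closed form. [folklore] -/
theorem exists_doubleFold_localModel :
    ∃ Q : 𝔼 4 → 𝔼 5, Manifold.IsSmoothEmbedding (𝓡 4) (𝓡 5) ∞ Q ∧
      shadowProj ∘ Q = doubleFoldModel ∧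
      (∀ u, u ∉ doubleFoldSpheres → Injective (mfderiv (𝓡 4) (𝓡 4) (shadowProj ∘ Q) u)) ∧
      (∀ u ∈ doubleFoldSpheres, ¬ Injective (mfderiv (𝓡 4) (𝓡 4) (shadowProj ∘ Q) u)) ∧
      (∀ u ∈ doubleFoldSpheres, IsWhitneyFoldAt (shadowProj ∘ Q) u) :=
  ⟨doubleFoldLift, isSmoothEmbedding_doubleFoldLift, shadowProj_comp_doubleFoldLift,
    fun _ hu => injective_mfderiv_shadowProj_doubleFoldLift hu,
    fun _ hu => not_injective_mfderiv_shadowProj_doubleFoldLift hu,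
    fun _ hu => isWhitneyFoldAt_shadowProj_doubleFoldLift hu⟩

/-! ### §3 The Whitney fold predicate: locality and invariance

`IsWhitneyFoldAt G u` only depends on the germ of `G` at `u`, and is invariant under linear
changes of coordinates in the target and affine changes of coordinates in the source — the
transfers used when a model pleat is implanted in a chart at some centre and scale. -/

/-- **Locality**: the Whitney fold predicate only depends on the germ of the map. [folklore] -/
theorem isWhitneyFoldAt_congr_of_eventuallyEq {G G' : 𝔼 4 → 𝔼 4} {u : 𝔼 4} (h : G =ᶠ[𝓝 u] G') :
    IsWhitneyFoldAt G u ↔ IsWhitneyFoldAt G' u := by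
  have h1 : fderiv ℝ G u = fderiv ℝ G' u := h.fderiv_eq
  have h2 : ∀ v : 𝔼 4,
      fderiv ℝ (fun w => fderiv ℝ G w v) u = fderiv ℝ (fun w => fderiv ℝ G' w v) u := by
    intro v
    apply Filter.EventuallyEq.fderiv_eq
    filter_upwards [h.fderiv (𝕜 := ℝ)] with w hw
    rw [hw]
  unfold IsWhitneyFoldAt
  simp only [h1, h2]

/-- **Target invariance**: post-composition with a linear automorphism of `ℝ⁴` does not change
the Whitney fold predicate (same kernel vector; the intrinsic second derivative and the image of
the differential are both moved by the automorphism). [folklore] -/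
theorem isWhitneyFoldAt_comp_continuousLinearEquiv_iff (L : 𝔼 4 ≃L[ℝ] 𝔼 4) (G : 𝔼 4 → 𝔼 4)
    (u : 𝔼 4) : IsWhitneyFoldAt (L ∘ G) u ↔ IsWhitneyFoldAt G u := by
  have hd : ∀ w, fderiv ℝ (L ∘ G) w = (L : 𝔼 4 →L[ℝ] 𝔼 4).comp (fderiv ℝ G w) := fun w =>
    L.comp_fderiv
  have hd2 : ∀ v, fderiv ℝ (fun w => fderiv ℝ (L ∘ G) w v) u =
      (L : 𝔼 4 →L[ℝ] 𝔼 4).comp (fderiv ℝ (fun w => fderiv ℝ G w v) u) := by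
    intro v
    have : (fun w => fderiv ℝ (L ∘ G) w v) = L ∘ fun w => fderiv ℝ G w v := by
      funext w
      rw [hd w]
      rfl
    rw [this, L.comp_fderiv]
  constructor
  · rintro ⟨v, hv0, hker, hrange⟩
    refine ⟨v, hv0, ?_, ?_⟩
    · rw [hd] at hker
      simpa using hker
    · rintro ⟨y, hy⟩
      apply hrange
      rw [hd2, hd]
      refine ⟨y, ?_⟩
      simp only [ContinuousLinearMap.coe_coe, ContinuousLinearMap.comp_apply] at hy ⊢
      rw [hy]
  · rintro ⟨v, hv0, hker, hrange⟩
    refine ⟨v, hv0, ?_, ?_⟩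
    · rw [hd]
      simp [hker]
    · rintro ⟨y, hy⟩
      apply hrange
      rw [hd2, hd] at hy
      refine ⟨y, ?_⟩
      simp only [ContinuousLinearMap.coe_coe, ContinuousLinearMap.comp_apply] at hy ⊢
      exact L.injective hy

/-- Target invariance under translations. [folklore] -/
theorem isWhitneyFoldAt_add_const_iff (c : 𝔼 4) (G : 𝔼 4 → 𝔼 4) (u : 𝔼 4) :
    IsWhitneyFoldAt (fun x => G x + c) u ↔ IsWhitneyFoldAt G u := by
  have hd : ∀ w, fderiv ℝ (fun x => G x + c) w = fderiv ℝ G w := fun w => fderiv_add_const c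
  unfold IsWhitneyFoldAt
  simp only [hd]

/-- **Source invariance** under affine automorphisms `x ↦ L x + c` of `ℝ⁴`: `G ∘ A` has a Whitney
fold at `u` iff `G` has one at `A u` (kernel vectors correspond under `L`; the intrinsic second
derivative is unchanged and the image of the differential is the same subspace). [folklore] -/
theorem isWhitneyFoldAt_comp_affine_iff (L : 𝔼 4 ≃L[ℝ] 𝔼 4) (c : 𝔼 4) (G : 𝔼 4 → 𝔼 4) (u : 𝔼 4) :
    IsWhitneyFoldAt (fun x => G (L x + c)) u ↔ IsWhitneyFoldAt G (L u + c) := by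
  -- first derivatives: `d(G ∘ A)(w) = dG(A w) ∘ L`
  have hd : ∀ (F : 𝔼 4 → 𝔼 4) (w : 𝔼 4),
      fderiv ℝ (fun x => F (L x + c)) w = (fderiv ℝ F (L w + c)).comp (L : 𝔼 4 →L[ℝ] 𝔼 4) := by
    intro F w
    have h1 : (fun x => F (L x + c)) = (fun y => F (y + c)) ∘ L := rfl
    rw [h1, L.comp_right_fderiv, fderiv_comp_add_right]
  -- second derivatives along corresponding kernel vectors
  have hd2 : ∀ v : 𝔼 4, fderiv ℝ (fun w => fderiv ℝ (fun x => G (L x + c)) w v) u v =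
      fderiv ℝ (fun y => fderiv ℝ G y (L v)) (L u + c) (L v) := by
    intro v
    have h1 : (fun w => fderiv ℝ (fun x => G (L x + c)) w v) =
        fun w => (fun y => fderiv ℝ G y (L v)) (L w + c) := by
      funext w
      rw [hd G w]
      rfl
    rw [h1, hd (fun y => fderiv ℝ G y (L v)) u]
    rfl
  constructor
  · rintro ⟨v, hv0, hker, hrange⟩
    refine ⟨L v, by simpa using hv0, ?_, ?_⟩
    · rw [hd G u] at hker
      exact hker
    · rw [hd2 v, hd G u] at hrange
      rintro ⟨y, hy⟩
      apply hrange
      refine ⟨L.symm y, ?_⟩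
      simp only [ContinuousLinearMap.coe_coe, ContinuousLinearMap.comp_apply] at hy ⊢
      simpa using hy
  · rintro ⟨v₀, hv0, hker, hrange⟩
    refine ⟨L.symm v₀, by simpa using hv0, ?_, ?_⟩
    · rw [hd G u]
      simpa using hker
    · rw [hd2, hd G u]
      rintro ⟨y, hy⟩
      apply hrange
      refine ⟨L y, ?_⟩
      simp only [ContinuousLinearMap.coe_coe, ContinuousLinearMap.comp_apply] at hy ⊢
      simpa using hy

/-! ### §4 Transversality to the vertical foliation = immersivity of the shadow

For a hypersurface `ι : M⁴ → ℝ⁵` with normal vector `n` at `m` (`n ⊥ dι(T_m M)`), the shadow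
`shadowProj ∘ ι` has injective differential at `m` as soon as `n` is not horizontal (`n₄ ≠ 0`):
this is how the "nowhere horizontal" clause of `HasTransversalRotation` and clause 7 of the fact
express transversality to the vertical line foliation (Eliashberg–Mishachev §3.3 with `ξ` the
vertical line field: `d^ξ f` surjective). -/

/-- **A hypersurface with non-horizontal normal has immersive shadow.**  If `ι` is differentiable
at `m` with injective differential and `n ⊥ dι_m(T_m M)` with `n₄ ≠ 0`, then
`d(shadowProj ∘ ι)_m` is injective: a tangent vector with vertical image `w = dι_m v` has
`⟪n, w⟫ = n₄ w₄ = 0`, so `w = 0`. [folklore] -/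
theorem injective_mfderiv_shadowProj_comp {M : Type*} [TopologicalSpace M] [ChartedSpace (𝔼 4) M]
    {ι : M → 𝔼 5} {m : M} (hι : MDifferentiableAt (𝓡 4) (𝓡 5) ι m)
    (hinj : Injective (mfderiv (𝓡 4) (𝓡 5) ι m)) {n : 𝔼 5}
    (hperp : ∀ v, ⟪n, (mfderiv (𝓡 4) (𝓡 5) ι m v : 𝔼 5)⟫_ℝ = 0) (hn : n 4 ≠ 0) :
    Injective (mfderiv (𝓡 4) (𝓡 4) (shadowProj ∘ ι) m) := by
  have hproj : HasMFDerivAt 𝓘(ℝ, 𝔼 5) 𝓘(ℝ, 𝔼 4) (shadowProjL : 𝔼 5 → 𝔼 4) (ι m) shadowProjL :=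
    shadowProjL.hasMFDerivAt
  have heq : mfderiv (𝓡 4) (𝓡 4) (shadowProj ∘ ι) m =
      (shadowProjL : 𝔼 5 →L[ℝ] 𝔼 4).comp (mfderiv (𝓡 4) (𝓡 5) ι m) :=
    (hproj.comp m hι.hasMFDerivAt).mfderiv
  rw [heq]
  -- a vector of `ℝ⁵` which is vertical and orthogonal to `n` vanishes
  have key : ∀ w : 𝔼 5, shadowProj w = 0 → ⟪n, w⟫_ℝ = 0 → w = 0 := by
    intro w hpw hnw
    have hc := apply_eq_zero_of_shadowProj_eq_zero hpw
    rw [PiLp.inner_apply, Fin.sum_univ_five] at hnw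
    simp [hc 0 (by decide), hc 1 (by decide), hc 2 (by decide), hc 3 (by decide), hn] at hnw
    ext i
    fin_cases i
    · simpa using hc 0 (by decide)
    · simpa using hc 1 (by decide)
    · simpa using hc 2 (by decide)
    · simpa using hc 3 (by decide)
    · simpa using hnw
  refine (injective_iff_map_eq_zero _).2 fun v hv => ?_
  apply (injective_iff_map_eq_zero _).1 hinj
  exact key _ hv (hperp v)

/-! ### §5 The round part: the position vector is the normal, the collar is transversal

On `{h ∘ ι₁ < 1 - δ₁}` the round-part hypothesis of the fact forces `‖ι₁‖ = 1`, so the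
differential of `ι₁` takes values in `(ι₁ m)^⊥`: the unit normal there is `± ι₁ m`, which is not
horizontal at positive height.  Consequently `ι₁` itself already satisfies the immersion clause 7
on the round collar `{0 < h ∘ ι₁ < 1 - δ₁}` — the input "`f` is already transversal to `ℱ` on
`𝒪p A`" of the relative form (Remark 2) of Eliashberg–Mishachev's Thm. 3.2. -/

section RoundPart

variable {M : Type*} [TopologicalSpace M] [ChartedSpace (𝔼 4) M] {ι₁ : M → 𝔼 5} {δ₁ : ℝ}

/-- Local notation: the round unit `4`-sphere of `ℝ⁵`. -/
local notation "𝕊⁴" => (Metric.sphere (0 : EuclideanSpace ℝ (Fin 5)) 1)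

omit [TopologicalSpace M] [ChartedSpace (𝔼 4) M] in
/-- Under the round-part hypothesis, points of `M` at `ι₁`-height `≤ 1 - δ₁` are mapped to the
unit sphere. [folklore] -/
theorem norm_eq_one_of_roundPart
    (hround : Set.range ι₁ ∩ {p : 𝔼 5 | p 4 ≤ 1 - δ₁} = (𝕊⁴ : Set (𝔼 5)) ∩ {p : 𝔼 5 | p 4 ≤ 1 - δ₁})
    {m : M} (hm : ι₁ m 4 ≤ 1 - δ₁) : ‖ι₁ m‖ = 1 := by
  have h : ι₁ m ∈ Set.range ι₁ ∩ {p : 𝔼 5 | p 4 ≤ 1 - δ₁} := ⟨Set.mem_range_self m, hm⟩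
  rw [hround] at h
  simpa using h.1

/-- **On the round part the position vector is normal to the hypersurface**: if `ι₁` is
continuous, differentiable at `m`, has round lower part up to the level `1 - δ₁` and
`h(ι₁ m) < 1 - δ₁`, then `⟪ι₁ m, dι₁(m) v⟫ = 0` for every tangent vector `v` (differentiate
`‖ι₁‖² = 1`, which holds on the open set `{h ∘ ι₁ < 1 - δ₁}`). [folklore] -/
theorem inner_self_mfderiv_eq_zero_of_roundPart (hcont : Continuous ι₁)
    (hround : Set.range ι₁ ∩ {p : 𝔼 5 | p 4 ≤ 1 - δ₁} = (𝕊⁴ : Set (𝔼 5)) ∩ {p : 𝔼 5 | p 4 ≤ 1 - δ₁})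
    {m : M} (hdiff : MDifferentiableAt (𝓡 4) (𝓡 5) ι₁ m) (hm : ι₁ m 4 < 1 - δ₁)
    (v : TangentSpace (𝓡 4) m) : ⟪ι₁ m, (mfderiv (𝓡 4) (𝓡 5) ι₁ m v : 𝔼 5)⟫_ℝ = 0 := by
  -- `‖ι₁‖² = 1` near `m`
  have hopen : IsOpen {m' : M | ι₁ m' 4 < 1 - δ₁} :=
    isOpen_lt ((continuous_apply 4).comp (PiLp.continuous_ofLp 2 _ |>.comp hcont))
      continuous_const
  have heq : (fun m' : M => ‖ι₁ m'‖ ^ 2) =ᶠ[𝓝 m] fun _ => (1 : ℝ) := by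
    filter_upwards [hopen.mem_nhds hm] with m' hm'
    rw [norm_eq_one_of_roundPart hround (le_of_lt hm'), one_pow]
  -- differentiate
  have hsq : HasMFDerivAt 𝓘(ℝ, 𝔼 5) 𝓘(ℝ, ℝ) (fun p : 𝔼 5 => ‖p‖ ^ 2) (ι₁ m)
      (2 • innerSL ℝ (ι₁ m)) :=
    (hasStrictFDerivAt_norm_sq (ι₁ m)).hasFDerivAt.hasMFDerivAt
  have hcomp := hsq.comp m hdiff.hasMFDerivAt
  have hzero : mfderiv (𝓡 4) 𝓘(ℝ, ℝ) (fun m' : M => ‖ι₁ m'‖ ^ 2) m = 0 := by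
    rw [heq.mfderiv_eq]
    exact mfderiv_const
  have h := hcomp.mfderiv
  rw [Function.comp_def, hzero] at h
  have h' := congrArg (fun L => L v) h
  simp only [zero_apply, ContinuousLinearMap.comp_apply] at h'
  have h'' : (2 : ℕ) • ⟪ι₁ m, (mfderiv (𝓡 4) (𝓡 5) ι₁ m v : 𝔼 5)⟫_ℝ = 0 := h'.symm
  exact (smul_eq_zero.1 h'').resolve_left two_ne_zero

/-- **The round collar is already transversal to the vertical foliation**: under the round-part
hypothesis, at a point of positive height `< 1 - δ₁` where `dι₁` is injective, the shadow
`shadowProj ∘ ι₁` has injective differential (the normal `ι₁ m` has height `≠ 0`). This is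
clause 7 of the fact for `ι = ι₁` on the collar, i.e. the hypothesis of the relative version
(Remark 2) of the theorem. [folklore] -/
theorem injective_mfderiv_shadowProj_comp_of_roundPart (hcont : Continuous ι₁)
    (hround : Set.range ι₁ ∩ {p : 𝔼 5 | p 4 ≤ 1 - δ₁} = (𝕊⁴ : Set (𝔼 5)) ∩ {p : 𝔼 5 | p 4 ≤ 1 - δ₁})
    {m : M} (hdiff : MDifferentiableAt (𝓡 4) (𝓡 5) ι₁ m)
    (hinj : Injective (mfderiv (𝓡 4) (𝓡 5) ι₁ m)) (hm : ι₁ m 4 < 1 - δ₁) (h0 : ι₁ m 4 ≠ 0) :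
    Injective (mfderiv (𝓡 4) (𝓡 4) (shadowProj ∘ ι₁) m) :=
  injective_mfderiv_shadowProj_comp hdiff hinj
    (inner_self_mfderiv_eq_zero_of_roundPart hcont hround hdiff hm) h0

/-- **On the round part the tangent space is the orthogonal complement of the position vector**
(when `dι₁(m)` is injective): every `w ⊥ ι₁ m` is a value `dι₁(m) v` — by `⟪ι₁ m, dι₁ v⟫ = 0`
and the dimension count `4 = 5 - 1`. [folklore] -/
theorem exists_mfderiv_eq_of_roundPart (hcont : Continuous ι₁)
    (hround : Set.range ι₁ ∩ {p : 𝔼 5 | p 4 ≤ 1 - δ₁} = (𝕊⁴ : Set (𝔼 5)) ∩ {p : 𝔼 5 | p 4 ≤ 1 - δ₁})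
    {m : M} (hdiff : MDifferentiableAt (𝓡 4) (𝓡 5) ι₁ m)
    (hinj : Injective (mfderiv (𝓡 4) (𝓡 5) ι₁ m)) (hm : ι₁ m 4 < 1 - δ₁) {w : 𝔼 5}
    (hw : ⟪ι₁ m, w⟫_ℝ = 0) : ∃ v, (mfderiv (𝓡 4) (𝓡 5) ι₁ m v : 𝔼 5) = w := by
  haveI : Fact (Module.finrank ℝ (𝔼 5) = 4 + 1) := ⟨by simp⟩
  have hm0 : ι₁ m ≠ 0 := by
    rw [← norm_ne_zero_iff, norm_eq_one_of_roundPart hround hm.le]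
    exact one_ne_zero
  -- the differential as an honest linear map `ℝ⁴ → ℝ⁵`
  let D : 𝔼 4 →ₗ[ℝ] 𝔼 5 :=
    { toFun := fun v => (mfderiv (𝓡 4) (𝓡 5) ι₁ m v : 𝔼 5)
      map_add' := fun v v' => (mfderiv (𝓡 4) (𝓡 5) ι₁ m).map_add v v'
      map_smul' := fun c v => (mfderiv (𝓡 4) (𝓡 5) ι₁ m).map_smul c v }
  have hinjD : Injective D := hinj
  have hle : LinearMap.range D ≤ (ℝ ∙ ι₁ m)ᗮ := by
    rintro _ ⟨v, rfl⟩
    exact Submodule.mem_orthogonal_singleton_iff_inner_right.2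
      (inner_self_mfderiv_eq_zero_of_roundPart hcont hround hdiff hm v)
  have heq : LinearMap.range D = (ℝ ∙ ι₁ m)ᗮ := by
    apply Submodule.eq_of_le_of_finrank_eq hle
    rw [LinearMap.finrank_range_of_inj hinjD,
      Submodule.finrank_orthogonal_span_singleton (n := 4) hm0]
    simp
  have hwmem : w ∈ LinearMap.range D := by
    rw [heq]
    exact Submodule.mem_orthogonal_singleton_iff_inner_right.2 hw
  obtain ⟨v, hv⟩ := hwmem
  exact ⟨v, hv⟩

/-- **On the round part a normal vector is a multiple of the position vector**: if
`⟪n, dι₁(m) v⟫ = 0` for all `v` (and `dι₁(m)` is injective), then `n ∈ ℝ · ι₁ m`. [folklore] -/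
theorem mem_span_of_inner_mfderiv_eq_zero_of_roundPart (hcont : Continuous ι₁)
    (hround : Set.range ι₁ ∩ {p : 𝔼 5 | p 4 ≤ 1 - δ₁} = (𝕊⁴ : Set (𝔼 5)) ∩ {p : 𝔼 5 | p 4 ≤ 1 - δ₁})
    {m : M} (hdiff : MDifferentiableAt (𝓡 4) (𝓡 5) ι₁ m)
    (hinj : Injective (mfderiv (𝓡 4) (𝓡 5) ι₁ m)) (hm : ι₁ m 4 < 1 - δ₁) {n : 𝔼 5}
    (hn : ∀ v, ⟪n, (mfderiv (𝓡 4) (𝓡 5) ι₁ m v : 𝔼 5)⟫_ℝ = 0) : n ∈ ℝ ∙ ι₁ m := by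
  haveI : Fact (Module.finrank ℝ (𝔼 5) = 4 + 1) := ⟨by simp⟩
  rw [← Submodule.orthogonal_orthogonal (ℝ ∙ ι₁ m), Submodule.mem_orthogonal]
  intro w hw
  obtain ⟨v, rfl⟩ := exists_mfderiv_eq_of_roundPart hcont hround hdiff hinj hm
    (Submodule.mem_orthogonal_singleton_iff_inner_right.1 hw)
  exact inner_eq_zero_symm.1 (hn v)

/-- **On the round part a unit normal is `± ι₁ m`.** [folklore] -/
theorem eq_or_eq_neg_of_inner_mfderiv_eq_zero_of_roundPart (hcont : Continuous ι₁)
    (hround : Set.range ι₁ ∩ {p : 𝔼 5 | p 4 ≤ 1 - δ₁} = (𝕊⁴ : Set (𝔼 5)) ∩ {p : 𝔼 5 | p 4 ≤ 1 - δ₁})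
    {m : M} (hdiff : MDifferentiableAt (𝓡 4) (𝓡 5) ι₁ m)
    (hinj : Injective (mfderiv (𝓡 4) (𝓡 5) ι₁ m)) (hm : ι₁ m 4 < 1 - δ₁) {n : 𝔼 5}
    (hn : ∀ v, ⟪n, (mfderiv (𝓡 4) (𝓡 5) ι₁ m v : 𝔼 5)⟫_ℝ = 0) (hn1 : ‖n‖ = 1) :
    n = ι₁ m ∨ n = -ι₁ m := by
  obtain ⟨a, ha⟩ := Submodule.mem_span_singleton.1
    (mem_span_of_inner_mfderiv_eq_zero_of_roundPart hcont hround hdiff hinj hm hn)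
  have h1 : ‖ι₁ m‖ = 1 := norm_eq_one_of_roundPart hround hm.le
  have habs : |a| = 1 := by
    have := congrArg norm ha
    rw [norm_smul, h1, mul_one, hn1, Real.norm_eq_abs] at this
    exact this
  rcases abs_eq (zero_le_one) |>.1 habs with h | h
  · left
    rw [← ha, h, one_smul]
  · right
    rw [← ha, h, neg_one_smul]

end RoundPart

/-! ### §6 The Whitney fold predicate under a change of coordinates in the target

Post-composition with a `C²` map `F` whose differential at `G u` is invertible does not change
`IsWhitneyFoldAt G u` (for `C²` maps `G`): the kernel vector is the same, the intrinsic second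
derivative is moved by `dF(G u)` (the extra term `D²F[dG v, ·]` of the Leibniz rule vanishes on
the kernel vector), and so is the image of the differential.  This is the transfer needed when a
radial pleat is read through a nonlinear chart of the leaf space. -/

section TargetDiffeo

variable {F G : 𝔼 4 → 𝔼 4} {u : 𝔼 4}

/-- Chain rule for the first derivatives of `F ∘ G` (`F, G` of class `C¹`). [folklore] -/
theorem fderiv_comp_of_contDiff (hF : ContDiff ℝ 2 F) (hG : ContDiff ℝ 2 G) (w : 𝔼 4) :
    fderiv ℝ (F ∘ G) w = (fderiv ℝ F (G w)).comp (fderiv ℝ G w) :=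
  fderiv_comp w (hF.differentiable (by simp) (G w)) (hG.differentiable (by simp) w)

/-- **Leibniz rule on a kernel vector**: if `dG(u) v = 0` then the intrinsic second derivative of
`F ∘ G` along `v` is `dF(G u)` applied to that of `G`. [folklore] -/
theorem fderiv_fderiv_comp_apply_of_apply_eq_zero (hF : ContDiff ℝ 2 F) (hG : ContDiff ℝ 2 G)
    {v : 𝔼 4} (hv : fderiv ℝ G u v = 0) :
    fderiv ℝ (fun w => fderiv ℝ (F ∘ G) w v) u v =
      fderiv ℝ F (G u) (fderiv ℝ (fun w => fderiv ℝ G w v) u v) := by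
  -- `w ↦ d(F ∘ G)(w) v = A(w) (B w)` with `A = dF ∘ G`, `B w = dG(w) v`
  have hA : DifferentiableAt ℝ (fun w => fderiv ℝ F (G w)) u :=
    ((hF.fderiv_right (m := 1) (by norm_num)).differentiable (by simp) (G u)).comp u
      (hG.differentiable (by simp) u)
  have hB : DifferentiableAt ℝ (fun w => fderiv ℝ G w v) u :=
    ((hG.fderiv_right (m := 1) (by norm_num)).differentiable (by simp) u).clm_apply
      (differentiableAt_const v)
  have hprod := hA.hasFDerivAt.clm_apply hB.hasFDerivAt
  have heq : (fun w => fderiv ℝ (F ∘ G) w v) = fun w => (fderiv ℝ F (G w)) (fderiv ℝ G w v) := by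
    funext w
    rw [fderiv_comp_of_contDiff hF hG w, ContinuousLinearMap.comp_apply]
  rw [heq, hprod.fderiv]
  simp [hv]

/-- **Target invariance under local diffeomorphisms**: for `C²` maps `F, G : ℝ⁴ → ℝ⁴` with
`dF(G u)` invertible, `F ∘ G` has a Whitney fold at `u` iff `G` does. [folklore] -/
theorem isWhitneyFoldAt_comp_iff_of_contDiff (hF : ContDiff ℝ 2 F) (hG : ContDiff ℝ 2 G)
    (L : 𝔼 4 ≃L[ℝ] 𝔼 4) (hL : fderiv ℝ F (G u) = (L : 𝔼 4 →L[ℝ] 𝔼 4)) :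
    IsWhitneyFoldAt (F ∘ G) u ↔ IsWhitneyFoldAt G u := by
  have hd : fderiv ℝ (F ∘ G) u = (L : 𝔼 4 →L[ℝ] 𝔼 4).comp (fderiv ℝ G u) := by
    rw [fderiv_comp_of_contDiff hF hG u, hL]
  constructor
  · rintro ⟨v, hv0, hker, hrange⟩
    have hkerG : fderiv ℝ G u v = 0 := by
      rw [hd] at hker
      simpa using hker
    refine ⟨v, hv0, hkerG, ?_⟩
    rintro ⟨y, hy⟩
    apply hrange
    rw [fderiv_fderiv_comp_apply_of_apply_eq_zero hF hG hkerG, hL, hd]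
    refine ⟨y, ?_⟩
    simp only [ContinuousLinearMap.coe_coe, ContinuousLinearMap.comp_apply] at hy ⊢
    rw [hy]
  · rintro ⟨v, hv0, hker, hrange⟩
    refine ⟨v, hv0, ?_, ?_⟩
    · rw [hd]
      simp [hker]
    · rintro ⟨y, hy⟩
      apply hrange
      rw [fderiv_fderiv_comp_apply_of_apply_eq_zero hF hG hker, hL, hd] at hy
      refine ⟨y, ?_⟩
      simp only [ContinuousLinearMap.coe_coe, ContinuousLinearMap.comp_apply] at hy ⊢
      exact L.injective hy

end TargetDiffeo

/-! ### §7 Radial pleats with a general profile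

The computations of §1 for `x ↦ ψ(‖x‖²) x` with an arbitrary `C²` profile `ψ : ℝ → ℝ`: the
differential is `ψ(‖x‖²) v + 2ψ'(‖x‖²)⟪x, v⟫ x`, with tangential eigenvalue `ψ(‖x‖²)` and radial
eigenvalue `radialFactor ψ (‖x‖²)`, `radialFactor ψ s = ψ s + 2 s ψ' s` (the derivative of the
radial profile `r ↦ r ψ(r²)` at `r = √s`); the map is an immersion where both are non-zero and has
a Whitney fold where the radial eigenvalue has a simple zero.  With `ψ = dfPhi` this is §1; a
profile with `ψ = 1` off a compact set gives a pleat equal to the identity far out, as needed to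
implant a double fold into a given transversal graph. -/

section RadialProfile

variable (ψ : ℝ → ℝ)

/-- The radial map with profile `ψ`: `x ↦ ψ(‖x‖²) x`. [folklore] -/
def radialMap (x : 𝔼 4) : 𝔼 4 := ψ (‖x‖ ^ 2) • x

/-- The radial eigenvalue of the differential of `radialMap ψ` as a function of `s = ‖x‖²`:
`ψ s + 2 s ψ'(s)`. [folklore] -/
def radialFactor (s : ℝ) : ℝ := ψ s + 2 * s * deriv ψ s

/-- The differential of `radialMap ψ` at `x`: `v ↦ ψ(‖x‖²) v + 2ψ'(‖x‖²)⟪x, v⟫ x`. [folklore] -/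
def radialMapDeriv (x : 𝔼 4) : 𝔼 4 →L[ℝ] 𝔼 4 :=
  ψ (‖x‖ ^ 2) • ContinuousLinearMap.id ℝ (𝔼 4) +
    (2 * deriv ψ (‖x‖ ^ 2)) • (innerSL ℝ x).smulRight x

variable {ψ}

/-- Unfolding of `radialMap`. [folklore] -/
theorem radialMap_apply (x : 𝔼 4) : radialMap ψ x = ψ (‖x‖ ^ 2) • x := rfl

/-- Unfolding of `radialMapDeriv`. [folklore] -/
theorem radialMapDeriv_apply (x v : 𝔼 4) :
    radialMapDeriv ψ x v = ψ (‖x‖ ^ 2) • v + (2 * deriv ψ (‖x‖ ^ 2) * ⟪x, v⟫_ℝ) • x := by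
  simp [radialMapDeriv, mul_smul]

/-- A radial map with `Cⁿ` profile is `Cⁿ`. [folklore] -/
theorem contDiff_radialMap {n : WithTop ℕ∞} (hψ : ContDiff ℝ n ψ) : ContDiff ℝ n (radialMap ψ) :=
  (hψ.comp (contDiff_norm_sq ℝ)).smul contDiff_id

/-- The scalar factor `x ↦ ψ(‖x‖²)` has derivative `ψ'(‖x‖²) · 2⟪x, ·⟫` at `x`. [folklore] -/
theorem hasFDerivAt_comp_norm_sq {x : 𝔼 4} (hψ : DifferentiableAt ℝ ψ (‖x‖ ^ 2)) :
    HasFDerivAt (fun y : 𝔼 4 => ψ (‖y‖ ^ 2)) (deriv ψ (‖x‖ ^ 2) • (2 • innerSL ℝ x)) x :=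
  hψ.hasDerivAt.comp_hasFDerivAt x (hasStrictFDerivAt_norm_sq x).hasFDerivAt

/-- The radial map has derivative `radialMapDeriv ψ x` at `x` (profile differentiable at
`‖x‖²`). [folklore] -/
theorem hasFDerivAt_radialMap {x : 𝔼 4} (hψ : DifferentiableAt ℝ ψ (‖x‖ ^ 2)) :
    HasFDerivAt (radialMap ψ) (radialMapDeriv ψ x) x := by
  have h := (hasFDerivAt_comp_norm_sq hψ).smul (hasFDerivAt_id (𝕜 := ℝ) x)
  refine h.congr_fderiv (ContinuousLinearMap.ext fun v => ?_)
  rw [radialMapDeriv_apply]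
  simp only [add_apply, smul_apply, ContinuousLinearMap.id_apply,
    ContinuousLinearMap.smulRight_apply, innerSL_apply_apply, id_eq, smul_eq_mul, nsmul_eq_mul,
    Nat.cast_ofNat]
  module

/-- `fderiv` of the radial map. [folklore] -/
theorem fderiv_radialMap {x : 𝔼 4} (hψ : DifferentiableAt ℝ ψ (‖x‖ ^ 2)) :
    fderiv ℝ (radialMap ψ) x = radialMapDeriv ψ x :=
  (hasFDerivAt_radialMap hψ).fderiv

/-- Pairing the differential with the position: `⟪x, dP(x) v⟫ = radialFactor ψ (‖x‖²) ⟪x, v⟫`.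
[folklore] -/
theorem inner_radialMapDeriv (x v : 𝔼 4) :
    ⟪x, radialMapDeriv ψ x v⟫_ℝ = radialFactor ψ (‖x‖ ^ 2) * ⟪x, v⟫_ℝ := by
  rw [radialMapDeriv_apply, inner_add_right, inner_smul_right, inner_smul_right,
    real_inner_self_eq_norm_sq, radialFactor]
  ring

/-- **Immersion criterion**: where the tangential eigenvalue `ψ(‖x‖²)` and the radial eigenvalue
`radialFactor ψ (‖x‖²)` are non-zero, the differential of the radial map is injective.
[folklore] -/
theorem injective_radialMapDeriv {x : 𝔼 4} (h1 : ψ (‖x‖ ^ 2) ≠ 0)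
    (h2 : radialFactor ψ (‖x‖ ^ 2) ≠ 0) : Injective (radialMapDeriv ψ x) := by
  refine (injective_iff_map_eq_zero _).2 fun v hv => ?_
  have h3 : radialFactor ψ (‖x‖ ^ 2) * ⟪x, v⟫_ℝ = 0 := by
    rw [← inner_radialMapDeriv, hv, inner_zero_right]
  have h4 : ⟪x, v⟫_ℝ = 0 := (mul_eq_zero.1 h3).resolve_left h2
  rw [radialMapDeriv_apply, h4, mul_zero, zero_smul, add_zero] at hv
  exact (smul_eq_zero.1 hv).resolve_left h1

/-- Where the radial eigenvalue vanishes, the radial direction is in the kernel. [folklore] -/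
theorem radialMapDeriv_self {u : 𝔼 4} (hu : radialFactor ψ (‖u‖ ^ 2) = 0) :
    radialMapDeriv ψ u u = 0 := by
  rw [radialMapDeriv_apply, real_inner_self_eq_norm_sq, ← add_smul]
  have : ψ (‖u‖ ^ 2) + 2 * deriv ψ (‖u‖ ^ 2) * ‖u‖ ^ 2 = radialFactor ψ (‖u‖ ^ 2) := by
    rw [radialFactor]
    ring
  rw [this, hu, zero_smul]

/-- Where the radial eigenvalue vanishes (and `u ≠ 0`), the differential is not injective.
[folklore] -/
theorem not_injective_radialMapDeriv {u : 𝔼 4} (hu0 : u ≠ 0)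
    (hu : radialFactor ψ (‖u‖ ^ 2) = 0) : ¬ Injective (radialMapDeriv ψ u) := fun h =>
  hu0 (h (by rw [radialMapDeriv_self hu, map_zero]))

/-- Along the radial line: `dP((1 + t) u) u = radialFactor ψ ((1 + t)²‖u‖²) u`. [folklore] -/
theorem radialMapDeriv_line (u : 𝔼 4) (t : ℝ) :
    radialMapDeriv ψ (u + t • u) u = radialFactor ψ ((1 + t) ^ 2 * ‖u‖ ^ 2) • u := by
  have hline : u + t • u = (1 + t) • u := by rw [add_smul, one_smul]
  rw [hline, radialMapDeriv_apply, norm_smul, real_inner_smul_left, real_inner_self_eq_norm_sq,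
    mul_pow, Real.norm_eq_abs, sq_abs, smul_smul, ← add_smul, radialFactor]
  congr 1
  ring

/-- The radial eigenvalue is differentiable for a `C²` profile. [folklore] -/
theorem differentiable_radialFactor (hψ : ContDiff ℝ 2 ψ) : Differentiable ℝ (radialFactor ψ) := by
  have h1 : Differentiable ℝ ψ := hψ.differentiable (by simp)
  have h2 : Differentiable ℝ (deriv ψ) := by
    have := hψ.iterate_deriv' 1 1
    simpa using this.differentiable (by simp)
  show Differentiable ℝ fun s => ψ s + 2 * s * deriv ψ s
  fun_prop

/-- **The intrinsic second derivative of a radial map along the radial kernel direction**: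
`D(w ↦ dP(w) u)(u)[u] = (radialFactor ψ)'(‖u‖²) · 2‖u‖² · u` (`ψ` of class `C²`). [folklore] -/
theorem fderiv_radialMapDeriv_self (hψ : ContDiff ℝ 2 ψ) (u : 𝔼 4) :
    fderiv ℝ (fun w => fderiv ℝ (radialMap ψ) w u) u u =
      (deriv (radialFactor ψ) (‖u‖ ^ 2) * (2 * ‖u‖ ^ 2)) • u := by
  have hψd : Differentiable ℝ ψ := hψ.differentiable (by simp)
  have hψ'd : Differentiable ℝ (deriv ψ) := by
    have := hψ.iterate_deriv' 1 1
    simpa using this.differentiable (by simp)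
  have hFeq : (fun w => fderiv ℝ (radialMap ψ) w u) =
      fun w => ψ (‖w‖ ^ 2) • u + (2 * deriv ψ (‖w‖ ^ 2) * ⟪w, u⟫_ℝ) • w := by
    funext w
    rw [fderiv_radialMap (hψd _), radialMapDeriv_apply]
  rw [hFeq]
  set F : 𝔼 4 → 𝔼 4 := fun w => ψ (‖w‖ ^ 2) • u + (2 * deriv ψ (‖w‖ ^ 2) * ⟪w, u⟫_ℝ) • w
    with hF
  -- `F` is differentiable
  have hn : Differentiable ℝ fun w : 𝔼 4 => ‖w‖ ^ 2 :=
    (contDiff_norm_sq ℝ : ContDiff ℝ 1 fun w : 𝔼 4 => ‖w‖ ^ 2).differentiable one_ne_zero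
  have hphi : Differentiable ℝ fun w : 𝔼 4 => ψ (‖w‖ ^ 2) := hψd.comp hn
  have hinner : Differentiable ℝ fun w : 𝔼 4 => ⟪w, u⟫_ℝ :=
    differentiable_id.inner ℝ (differentiable_const u)
  have hg : Differentiable ℝ fun w : 𝔼 4 => 2 * deriv ψ (‖w‖ ^ 2) * ⟪w, u⟫_ℝ :=
    ((differentiable_const _).mul (hψ'd.comp hn)).mul hinner
  have hFd : Differentiable ℝ F := (hphi.smul_const u).add (hg.smul differentiable_id)
  -- restrict to the radial line `t ↦ u + t u`
  have hl : HasDerivAt (fun t : ℝ => u + t • u) u 0 := by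
    simpa using ((hasDerivAt_id' (0 : ℝ)).smul_const u).const_add u
  have hFd' : HasFDerivAt F (fderiv ℝ F u) (u + (0 : ℝ) • u) := by
    rw [zero_smul, add_zero]
    exact (hFd u).hasFDerivAt
  have hcomp : HasDerivAt (fun t : ℝ => F (u + t • u)) (fderiv ℝ F u u) 0 := by
    have h := hFd'.comp_hasDerivAt (0 : ℝ) hl
    rw [Function.comp_def] at h
    exact h
  -- along that line `F` is `radialFactor ψ ((1+t)²‖u‖²) u`
  have hline : (fun t : ℝ => F (u + t • u)) = fun t => radialFactor ψ ((1 + t) ^ 2 * ‖u‖ ^ 2) • u := by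
    funext t
    rw [hF, ← radialMapDeriv_line u t, radialMapDeriv_apply]
  rw [hline] at hcomp
  -- whose derivative at `0` is explicit
  have h1 : HasDerivAt (fun t : ℝ => (1 + t) ^ 2 * ‖u‖ ^ 2) (2 * ‖u‖ ^ 2) 0 :=
    ((((hasDerivAt_id' (0 : ℝ)).const_add 1).pow 2).mul_const (‖u‖ ^ 2)).congr_deriv
      (by norm_num)
  have h2 : HasDerivAt (radialFactor ψ) (deriv (radialFactor ψ) (‖u‖ ^ 2))
      ((1 + (0 : ℝ)) ^ 2 * ‖u‖ ^ 2) := by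
    rw [show (1 + (0 : ℝ)) ^ 2 * ‖u‖ ^ 2 = ‖u‖ ^ 2 by ring]
    exact (differentiable_radialFactor hψ (‖u‖ ^ 2)).hasDerivAt
  have hexp : HasDerivAt (fun t : ℝ => radialFactor ψ ((1 + t) ^ 2 * ‖u‖ ^ 2) • u)
      ((deriv (radialFactor ψ) (‖u‖ ^ 2) * (2 * ‖u‖ ^ 2)) • u) 0 := by
    have h := (h2.comp 0 h1).smul_const u
    rw [Function.comp_def] at h
    exact h
  exact hcomp.unique hexp

/-- **Whitney fold of a radial map at a simple zero of the radial eigenvalue**: if `u ≠ 0`,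
`radialFactor ψ (‖u‖²) = 0` and `(radialFactor ψ)'(‖u‖²) ≠ 0` (profile of class `C²`), then
`radialMap ψ` has a Whitney fold at `u`. [folklore] -/
theorem isWhitneyFoldAt_radialMap (hψ : ContDiff ℝ 2 ψ) {u : 𝔼 4} (hu0 : u ≠ 0)
    (h0 : radialFactor ψ (‖u‖ ^ 2) = 0) (h1 : deriv (radialFactor ψ) (‖u‖ ^ 2) ≠ 0) :
    IsWhitneyFoldAt (radialMap ψ) u := by
  have hψd : Differentiable ℝ ψ := hψ.differentiable (by simp)
  have hsq : ‖u‖ ^ 2 ≠ 0 := pow_ne_zero 2 (norm_ne_zero_iff.2 hu0)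
  have hc0 : deriv (radialFactor ψ) (‖u‖ ^ 2) * (2 * ‖u‖ ^ 2) ≠ 0 :=
    mul_ne_zero h1 (mul_ne_zero two_ne_zero hsq)
  refine ⟨u, hu0, ?_, ?_⟩
  · rw [fderiv_radialMap (hψd _), radialMapDeriv_self h0]
  · rw [fderiv_radialMapDeriv_self hψ, fderiv_radialMap (hψd _)]
    rintro ⟨v, hv⟩
    have hv' : radialMapDeriv ψ u v = (deriv (radialFactor ψ) (‖u‖ ^ 2) * (2 * ‖u‖ ^ 2)) • u := hv
    have h2 : ⟪u, radialMapDeriv ψ u v⟫_ℝ = 0 := by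
      rw [inner_radialMapDeriv, h0, zero_mul]
    rw [hv', inner_smul_right, real_inner_self_eq_norm_sq] at h2
    rcases mul_eq_zero.1 h2 with h | h
    · exact hc0 h
    · exact hsq h

/-! #### Lifts to `ℝ⁵` with a prescribed height -/

/-- Padding a point of `ℝ⁴` with a fifth (height) coordinate. [folklore] -/
def pad5 (y : 𝔼 4) (t : ℝ) : 𝔼 5 := WithLp.toLp 2 ![y 0, y 1, y 2, y 3, t]

omit ψ in
/-- The shadow of a padded point. [folklore] -/
@[simp] theorem shadowProj_pad5 (y : 𝔼 4) (t : ℝ) : shadowProj (pad5 y t) = y := by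
  ext i
  fin_cases i <;> simp [shadowProj, pad5]

omit ψ in
/-- The height of a padded point. [folklore] -/
@[simp] theorem pad5_apply_four (y : 𝔼 4) (t : ℝ) : pad5 y t 4 = t := by
  simp [pad5]

omit ψ in
/-- `pad5` is jointly `C^∞` (it is linear). [folklore] -/
theorem contDiff_pad5 {P : 𝔼 4 → 𝔼 4} {η : 𝔼 4 → ℝ} {n : WithTop ℕ∞} (hP : ContDiff ℝ n P)
    (hη : ContDiff ℝ n η) : ContDiff ℝ n fun x => pad5 (P x) (η x) := by
  rw [contDiff_euclidean]
  have hP' := contDiff_euclidean.1 hP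
  intro i
  fin_cases i
  · simpa [pad5] using hP' 0
  · simpa [pad5] using hP' 1
  · simpa [pad5] using hP' 2
  · simpa [pad5] using hP' 3
  · simpa [pad5] using hη

omit ψ in
/-- **The differential of a lift `x ↦ (P x, η x)` kills exactly the common kernel of `dP` and
`dη`.** [folklore] -/
theorem fderiv_pad5_apply_eq_zero_iff {P : 𝔼 4 → 𝔼 4} {η : 𝔼 4 → ℝ} {x : 𝔼 4}
    (hP : DifferentiableAt ℝ P x) (hη : DifferentiableAt ℝ η x) (v : 𝔼 4) :
    fderiv ℝ (fun x => pad5 (P x) (η x)) x v = 0 ↔ fderiv ℝ P x v = 0 ∧ fderiv ℝ η x v = 0 := by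
  have hQ : DifferentiableAt ℝ (fun x => pad5 (P x) (η x)) x := by
    rw [differentiableAt_euclidean]
    have hP' := differentiableAt_euclidean.1 hP
    intro i
    fin_cases i
    · simpa [pad5] using hP' 0
    · simpa [pad5] using hP' 1
    · simpa [pad5] using hP' 2
    · simpa [pad5] using hP' 3
    · simpa [pad5] using hη
  -- shadow component
  have h1 : (shadowProjL : 𝔼 5 →L[ℝ] 𝔼 4).comp (fderiv ℝ (fun x => pad5 (P x) (η x)) x) =
      fderiv ℝ P x := by
    have h := shadowProjL.hasFDerivAt.comp x hQ.hasFDerivAt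
    have heq : (shadowProjL : 𝔼 5 → 𝔼 4) ∘ (fun x => pad5 (P x) (η x)) = P := by
      funext y
      exact shadowProj_pad5 (P y) (η y)
    rw [heq] at h
    exact h.unique hP.hasFDerivAt
  -- height component
  have h2 : (EuclideanSpace.proj (4 : Fin 5) : 𝔼 5 →L[ℝ] ℝ).comp
      (fderiv ℝ (fun x => pad5 (P x) (η x)) x) = fderiv ℝ η x := by
    have h := (EuclideanSpace.proj (4 : Fin 5) : 𝔼 5 →L[ℝ] ℝ).hasFDerivAt.comp x hQ.hasFDerivAt
    have heq : ((EuclideanSpace.proj (4 : Fin 5) : 𝔼 5 →L[ℝ] ℝ) : 𝔼 5 → ℝ) ∘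
        (fun x => pad5 (P x) (η x)) = η := by
      funext y
      simp
    rw [heq] at h
    exact h.unique hη.hasFDerivAt
  constructor
  · intro hv
    constructor
    · rw [← h1, ContinuousLinearMap.comp_apply, hv, map_zero]
    · rw [← h2, ContinuousLinearMap.comp_apply, hv, map_zero]
  · rintro ⟨hvP, hvη⟩
    have hc : ∀ i : Fin 5, i ≠ 4 → (fderiv ℝ (fun x => pad5 (P x) (η x)) x v) i = 0 := by
      have hs : shadowProj (fderiv ℝ (fun x => pad5 (P x) (η x)) x v) = 0 := by
        have := congrArg (fun L : 𝔼 4 →L[ℝ] 𝔼 4 => L v) h1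
        simp only [ContinuousLinearMap.comp_apply, hvP] at this
        exact this
      exact apply_eq_zero_of_shadowProj_eq_zero hs
    have h4 : (fderiv ℝ (fun x => pad5 (P x) (η x)) x v) 4 = 0 := by
      have := congrArg (fun L : 𝔼 4 →L[ℝ] ℝ => L v) h2
      simpa [hvη] using this
    ext i
    fin_cases i
    · simpa using hc 0 (by decide)
    · simpa using hc 1 (by decide)
    · simpa using hc 2 (by decide)
    · simpa using hc 3 (by decide)
    · simpa using h4

end RadialProfile

/-! ### §8 The formal datum can be taken smooth (Part A of the printed proof's input)

`HasTransversalRotation ι₁ δ₁ δ` only asks for a CONTINUOUS unit normal field `ν` and a continuous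
homotopy of unit fields; the engine of the printed proof (Thm. 2.2/2.10 applied to the tangential
rotation `G^t = ν_t^⊥`) wants a smooth rotation.  Using `HypersurfaceNormalField.lean`: `ν` is
automatically `C^∞` (`contMDiff_of_continuous_unitNormal`), and the homotopy, re-timed to be
constant near `t = 0` and read on the manifold `M × ℝ`, is smooth near the closed set where it must
be kept (`{h ∘ ι₁ ≤ 1 - δ₁'} × ℝ ∪ M × (-∞, 0]`, on a neighbourhood of which it equals `ν ∘ fst`),
so `exists_contMDiff_unit_approx` replaces it by a smooth homotopy of unit fields, equal to `ν` at
`t = 0` and on the smaller round region, and still nowhere horizontal at `t = 1` on the compact top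
part `{h ∘ ι₁ ≥ 1 - δ}` (uniform approximation within half the minimum of `|ν₁ ₄|` there). -/

section SmoothDatum

variable {M : Type*} [TopologicalSpace M] [T2Space M] [CompactSpace M] [ChartedSpace (𝔼 4) M]
  [IsManifold (𝓡 4) ∞ M] {ι₁ : M → 𝔼 5} {δ₁ δ : ℝ}

/-- Local notation: the round unit `4`-sphere of `ℝ⁵`. -/
local notation "𝕊⁴" => (Metric.sphere (0 : EuclideanSpace ℝ (Fin 5)) 1)

omit [T2Space M] [CompactSpace M] in
/-- The unit normal field of the datum is `C^∞` (it is continuous, unit and normal along a `C^∞`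
immersion). [folklore] -/
theorem HasTransversalRotation.contMDiff_normal (hsm : ContMDiff (𝓡 4) (𝓡 5) ∞ ι₁)
    (hinj : ∀ m, Injective (mfderiv (𝓡 4) (𝓡 5) ι₁ m)) {ν : C(M, 𝕊⁴)}
    (hν : ∀ (m : M) (v : TangentSpace (𝓡 4) m),
      ⟪((ν m : 𝕊⁴) : 𝔼 5), (mfderiv (𝓡 4) (𝓡 5) ι₁ m v : 𝔼 5)⟫_ℝ = 0) :
    ContMDiff (𝓡 4) 𝓘(ℝ, 𝔼 5) ∞ fun m => ((ν m : 𝕊⁴) : 𝔼 5) :=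
  contMDiff_of_continuous_unitNormal (k := 4) hsm hinj
    (continuous_subtype_val.comp ν.continuous) (fun m => by simp) hν

/-- **The formal datum, smoothed.**  From `HasTransversalRotation ι₁ δ₁ δ` along a `C^∞` immersion
`ι₁` of a compact `M` one gets, for every `δ₁' > δ₁`, a `C^∞` map `Φ : M × ℝ → ℝ⁵` such that:
every `Φ p` is a unit vector; `Φ(m, 0) ⊥ dι₁(T_m M)` (so `Φ(·, 0)` is the smooth unit normal
field); `Φ(m, t) = Φ(m, 0)` for all `t` whenever `h(ι₁ m) ≤ 1 - δ₁'`; and `Φ(m, 1)` is nowhere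
horizontal (`Φ(m, 1)₄ ≠ 0`) on `{h ∘ ι₁ ≥ 1 - δ}` — a smooth rotation of the normal line, constant
on the smaller round region, ending transversal to the vertical foliation on the top part (the
hypothesis of Eliashberg–Mishachev's Thm. 3.2 with Remark 2, in smooth Gauss-map form).
[cite: EliashbergMishachev2009, §2.1 and Thm. 3.2 with Remark 2] -/
theorem HasTransversalRotation.exists_smooth_rotation (hsm : ContMDiff (𝓡 4) (𝓡 5) ∞ ι₁)
    (hinj : ∀ m, Injective (mfderiv (𝓡 4) (𝓡 5) ι₁ m)) (h : HasTransversalRotation ι₁ δ₁ δ)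
    {δ₁' : ℝ} (hδ₁' : δ₁ < δ₁') :
    ∃ Φ : M × ℝ → 𝔼 5, ContMDiff ((𝓡 4).prod 𝓘(ℝ, ℝ)) 𝓘(ℝ, 𝔼 5) ∞ Φ ∧
      (∀ p, ‖Φ p‖ = 1) ∧
      (∀ (m : M) (v : TangentSpace (𝓡 4) m),
        ⟪Φ (m, 0), (mfderiv (𝓡 4) (𝓡 5) ι₁ m v : 𝔼 5)⟫_ℝ = 0) ∧
      (∀ m : M, ι₁ m 4 ≤ 1 - δ₁' → ∀ t : ℝ, Φ (m, t) = Φ (m, 0)) ∧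
      ∀ m : M, 1 - δ ≤ ι₁ m 4 → Φ (m, 1) 4 ≠ 0 := by
  obtain ⟨ν, ν₁, hνn, hν₁, ⟨H⟩⟩ := h
  -- the data as maps into `ℝ⁵`
  set νv : M → 𝔼 5 := fun m => ((ν m : 𝕊⁴) : 𝔼 5) with hνv
  have hνv_smooth : ContMDiff (𝓡 4) 𝓘(ℝ, 𝔼 5) ∞ νv :=
    HasTransversalRotation.contMDiff_normal hsm hinj hνn
  -- the re-timed homotopy on `M × ℝ`: constant (= ν) for `t ≤ 1/4`, `= ν₁` for `t ≥ 3/4`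
  set θ : ℝ → unitInterval := fun t => Set.projIcc 0 1 zero_le_one (2 * t - 1 / 2) with hθ
  have hθc : Continuous θ := continuous_projIcc.comp (by fun_prop)
  set G : M × ℝ → 𝔼 5 := fun p => ((H (θ p.2, p.1) : 𝕊⁴) : 𝔼 5) with hG
  have hGc : Continuous G :=
    continuous_subtype_val.comp (H.continuous.comp ((hθc.comp continuous_snd).prodMk continuous_fst))
  have hG1 : ∀ p, ‖G p‖ = 1 := fun p => by simp [hG]
  have hθ0 : ∀ t : ℝ, t < 1 / 4 → θ t = 0 := by
    intro t ht
    simp only [hθ]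
    rw [Set.projIcc_of_le_left _ (by linarith)]
    rfl
  have hθ1 : θ 1 = 1 := by
    simp only [hθ]
    rw [Set.projIcc_of_right_le _ (by norm_num)]
    rfl
  -- where `G` agrees with `ν ∘ fst`
  have hGν_round : ∀ (m : M) (t : ℝ), ι₁ m 4 ≤ 1 - δ₁ → G (m, t) = νv m := by
    intro m t hm
    simp only [hG, hνv]
    rw [H.eq_fst (θ t) hm]
  have hGν_time : ∀ (m : M) (t : ℝ), t < 1 / 4 → G (m, t) = νv m := by
    intro m t ht
    simp only [hG, hνv]
    rw [hθ0 t ht, H.apply_zero]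
  -- the closed set to keep, and an open set around it on which `G = ν ∘ fst`
  set S : Set (M × ℝ) := {p | ι₁ p.1 4 ≤ 1 - δ₁'} ∪ {p | p.2 ≤ 0} with hS
  set U : Set (M × ℝ) := {p | ι₁ p.1 4 < 1 - δ₁} ∪ {p | p.2 < 1 / 4} with hU
  have hh : Continuous fun p : M × ℝ => ι₁ p.1 4 :=
    (continuous_apply 4).comp ((PiLp.continuous_ofLp 2 _).comp (hsm.continuous.comp continuous_fst))
  have hSc : IsClosed S := (isClosed_le hh continuous_const).union (isClosed_le continuous_snd continuous_const)
  have hUo : IsOpen U := (isOpen_lt hh continuous_const).union (isOpen_lt continuous_snd continuous_const)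
  have hSU : S ⊆ U := by
    rintro ⟨m, t⟩ (hp | hp)
    · left
      show ι₁ m 4 < 1 - δ₁
      have : ι₁ m 4 ≤ 1 - δ₁' := hp
      linarith
    · right
      show t < 1 / 4
      have : t ≤ 0 := hp
      linarith
  have hGU : ∀ p ∈ U, G p = νv p.1 := by
    rintro ⟨m, t⟩ (hp | hp)
    · exact hGν_round m t (le_of_lt hp)
    · exact hGν_time m t hp
  have hGsmooth : ContMDiffOn ((𝓡 4).prod 𝓘(ℝ, ℝ)) 𝓘(ℝ, 𝔼 5) ∞ G U :=
    (hνv_smooth.comp contMDiff_fst).contMDiffOn.congr hGU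
  -- the margin on the compact top part
  obtain ⟨c, hc, hcT⟩ : ∃ c : ℝ, 0 < c ∧ ∀ m : M, 1 - δ ≤ ι₁ m 4 → c ≤ |((ν₁ m : 𝕊⁴) : 𝔼 5) 4| := by
    set T : Set M := {m | 1 - δ ≤ ι₁ m 4} with hT
    have hTc : IsCompact T := (isClosed_le continuous_const
      ((continuous_apply 4).comp ((PiLp.continuous_ofLp 2 _).comp hsm.continuous))).isCompact
    have hgc : Continuous fun m : M => |((ν₁ m : 𝕊⁴) : 𝔼 5) 4| :=
      continuous_abs.comp ((continuous_apply 4).comp ((PiLp.continuous_ofLp 2 _).comp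
        (continuous_subtype_val.comp ν₁.continuous)))
    rcases T.eq_empty_or_nonempty with hTe | hTne
    · refine ⟨1, one_pos, fun m hm => ?_⟩
      have : m ∈ T := hm
      rw [hTe] at this
      exact this.elim
    · obtain ⟨m₀, hm₀, hmin⟩ := hTc.exists_isMinOn hTne hgc.continuousOn
      refine ⟨|((ν₁ m₀ : 𝕊⁴) : 𝔼 5) 4|, abs_pos.2 (hν₁ m₀ hm₀), fun m hm => hmin hm⟩
  -- smooth relative approximation by unit fields
  obtain ⟨Φ, hΦs, hΦ1, hΦS, hΦd⟩ := exists_contMDiff_unit_approx ((𝓡 4).prod 𝓘(ℝ, ℝ)) hGc hG1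
    hSc (hUo.mem_nhdsSet.2 hSU) hGsmooth (half_pos hc)
  refine ⟨Φ, hΦs, hΦ1, ?_, ?_, ?_⟩
  · -- at `t = 0`: `Φ = G = ν`, the unit normal
    intro m v
    have h0 : Φ (m, 0) = νv m := by
      rw [hΦS (show ((m, (0 : ℝ)) : M × ℝ) ∈ S from Or.inr (le_refl (0 : ℝ))),
        hGν_time m 0 (by norm_num)]
    rw [h0]
    exact hνn m v
  · -- constant in `t` on the smaller round region
    intro m hm t
    have h1 : Φ (m, t) = νv m := by
      rw [hΦS (show ((m, t) : M × ℝ) ∈ S from Or.inl hm), hGν_round m t (by linarith)]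
    have h2 : Φ (m, 0) = νv m := by
      rw [hΦS (show ((m, (0 : ℝ)) : M × ℝ) ∈ S from Or.inr (le_refl (0 : ℝ))),
        hGν_time m 0 (by norm_num)]
    rw [h1, h2]
  · -- nowhere horizontal at `t = 1` on the top part
    intro m hm h0
    have hG1m : G (m, 1) = ((ν₁ m : 𝕊⁴) : 𝔼 5) := by
      simp only [hG]
      rw [hθ1, H.apply_one]
    have hclose : ‖Φ (m, 1) - G (m, 1)‖ < c / 2 := hΦd (m, 1)
    have hcoord : |((ν₁ m : 𝕊⁴) : 𝔼 5) 4| ≤ ‖Φ (m, 1) - G (m, 1)‖ := by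
      have h4 : (Φ (m, 1) - G (m, 1)) 4 = -(((ν₁ m : 𝕊⁴) : 𝔼 5) 4) := by
        rw [hG1m, PiLp.sub_apply, h0, zero_sub]
      calc |((ν₁ m : 𝕊⁴) : 𝔼 5) 4| = ‖(Φ (m, 1) - G (m, 1)) 4‖ := by
            rw [h4, Real.norm_eq_abs, abs_neg]
        _ ≤ ‖Φ (m, 1) - G (m, 1)‖ := PiLp.norm_apply_le _ 4
    have := hcT m hm
    linarith

end SmoothDatum

/-! ### §10 Reduction of the fact to the wrinkled-embeddings engine

`EliashbergMishachev2009_doubleFolds_of_engine`: the fact follows from the ENGINE of the printed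
proof stated in smooth Gauss-map form on a CLOSED `4`-manifold — Eliashberg–Mishachev's
Thm. 2.10 in its relative form (`V = M`, `C = A`: a homotopy of folded embeddings with spherical
double folds whose Gauss map follows a given rotation of the normal line, fixed where the
rotation is constant), followed by the regularization of §2.3 B / Lemma "F-regularization-1"
near the double folds (all outside `A`, where the final planes are transversal to the vertical)
and the round packaging — combined with everything above: §8 supplies the smooth rotation,
§5 the transversality of the frozen round collar, and the levels `δ₁ < δ₁' < δ_mid < δ` the
bookkeeping of clauses 3–5.  The engine itself (parts B and C of the printed proof) is NOT
proved in the tree; this theorem fixes its interface and machine-checks the glue. -/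

section Engine

/-- Local notation: the round unit `4`-sphere of `ℝ⁵`. -/
local notation "𝕊⁴" => (Metric.sphere (0 : EuclideanSpace ℝ (Fin 5)) 1)

/-- **The fact, from the engine.**  Hypothesis `engine`: for every closed smooth `4`-manifold
`M`, `C^∞` injective immersion `ι : M → ℝ⁵`, `C^∞` homotopy `Φ : M × ℝ → ℝ⁵` of unit vector
fields starting at a unit normal field of `ι`, closed `A ⊆` open `O` with `Φ` constant in time
on `O` and `Φ(·, 1)` nowhere horizontal on `closure Aᶜ`, and `ε > 0`, there is a smooth
embedding `ι'`, `ε`-close to `ι`, equal to `ι` near `A`, with finitely many charts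
`e j : ℝ⁴ ↪ M ∖ A` having pairwise disjoint images of `doubleFoldSpheres`, the shadow
`shadowProj ∘ ι'` immersive on `M ∖ A` off those images and with a Whitney fold, read in `e j`,
at each of their points (Eliashberg–Mishachev 2009, Thm. 2.10 relative + §2.3 B, Gauss-map
form, hypersurfaces of `ℝ⁵`, vertical line field).  Conclusion: the fact.
[cite: EliashbergMishachev2009, Thm. 2.10, §2.3 B, Thm. 3.2 Remark 2] -/
theorem EliashbergMishachev2009_doubleFolds_of_engine
    (engine : ∀ (M : Type) [TopologicalSpace M] [T2Space M] [SecondCountableTopology M]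
      [CompactSpace M] [ChartedSpace (𝔼 4) M] [IsManifold (𝓡 4) ∞ M] (ι : M → 𝔼 5),
      ContMDiff (𝓡 4) (𝓡 5) ∞ ι → Injective ι → (∀ m, Injective (mfderiv (𝓡 4) (𝓡 5) ι m)) →
      ∀ (Φ : M × ℝ → 𝔼 5), ContMDiff ((𝓡 4).prod 𝓘(ℝ, ℝ)) 𝓘(ℝ, 𝔼 5) ∞ Φ →
      (∀ p, ‖Φ p‖ = 1) →
      (∀ (m : M) (v : TangentSpace (𝓡 4) m),
        ⟪Φ (m, 0), (mfderiv (𝓡 4) (𝓡 5) ι m v : 𝔼 5)⟫_ℝ = 0) →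
      ∀ (A O : Set M), IsClosed A → IsOpen O → A ⊆ O →
      (∀ m ∈ O, ∀ t : ℝ, Φ (m, t) = Φ (m, 0)) →
      (∀ m ∈ closure Aᶜ, Φ (m, 1) 4 ≠ 0) →
      ∀ ε : ℝ, 0 < ε →
      ∃ (ι' : M → 𝔼 5) (k : ℕ) (e : Fin k → 𝔼 4 → M),
        Manifold.IsSmoothEmbedding (𝓡 4) (𝓡 5) ∞ ι' ∧
        (∀ m, dist (ι' m) (ι m) < ε) ∧
        (∃ O' : Set M, IsOpen O' ∧ A ⊆ O' ∧ ∀ m ∈ O', ι' m = ι m) ∧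
        (∀ j, Manifold.IsSmoothEmbedding (𝓡 4) (𝓡 4) ∞ (e j) ∧ ∀ u, e j u ∉ A) ∧
        Pairwise (Function.onFun Disjoint fun j => e j '' doubleFoldSpheres) ∧
        (∀ m, m ∉ A → m ∉ (⋃ j, e j '' doubleFoldSpheres) →
          Injective (mfderiv (𝓡 4) (𝓡 4) (shadowProj ∘ ι') m)) ∧
        (∀ j, ∀ u ∈ doubleFoldSpheres, IsWhitneyFoldAt (shadowProj ∘ ι' ∘ e j) u)) :
    EliashbergMishachev2009_doubleFolds_of_hasTransversalRotation := by
  intro M _ _ _ _ _ _ ι₁ δ₁ δ hι₁ hδ₁ hδ₁δ hδ1 hround hdat ε hε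
  -- smooth data of the embedding
  have hsm : ContMDiff (𝓡 4) (𝓡 5) ∞ ι₁ := hι₁.isImmersion.contMDiff
  have hinjι : Injective ι₁ := hι₁.isEmbedding.injective
  have hinjd : ∀ m, Injective (mfderiv (𝓡 4) (𝓡 5) ι₁ m) :=
    Literature.Topology.FourManifolds.mfderiv_injective_of_isImmersion hι₁.isImmersion (by simp)
  have hcont : Continuous ι₁ := hsm.continuous
  -- intermediate levels `δ₁ < δ₁' < δm < δ`
  set δ₁' : ℝ := (2 * δ₁ + δ) / 3 with hδ₁'
  set δm : ℝ := (δ₁ + 2 * δ) / 3 with hδm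
  have h1 : δ₁ < δ₁' := by rw [hδ₁']; linarith
  have h2 : δ₁' < δm := by rw [hδ₁', hδm]; linarith
  have h3 : δm < δ := by rw [hδm]; linarith
  -- the smooth rotation (§8)
  obtain ⟨Φ, hΦs, hΦ1, hΦn, hΦconst, hΦtop⟩ := hdat.exists_smooth_rotation hsm hinjd h1
  -- frozen set and its neighbourhood
  set A : Set M := {m | ι₁ m 4 ≤ 1 - δm} with hA
  set O : Set M := {m | ι₁ m 4 < 1 - δ₁'} with hO
  have hh : Continuous fun m : M => ι₁ m 4 :=
    (continuous_apply 4).comp ((PiLp.continuous_ofLp 2 _).comp hcont)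
  have hAc : IsClosed A := isClosed_le hh continuous_const
  have hOo : IsOpen O := isOpen_lt hh continuous_const
  have hAO : A ⊆ O := fun m hm => by
    show ι₁ m 4 < 1 - δ₁'
    have : ι₁ m 4 ≤ 1 - δm := hm
    linarith
  have hOconst : ∀ m ∈ O, ∀ t : ℝ, Φ (m, t) = Φ (m, 0) := fun m hm t =>
    hΦconst m (le_of_lt hm) t
  have hclA : ∀ m ∈ closure Aᶜ, 1 - δm ≤ ι₁ m 4 := by
    have hcl : closure Aᶜ ⊆ {m | 1 - δm ≤ ι₁ m 4} := by
      apply closure_minimal _ (isClosed_le continuous_const hh)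
      intro m hm
      simp only [hA, mem_compl_iff, mem_setOf_eq, not_le] at hm
      exact le_of_lt hm
    exact fun m hm => hcl hm
  have htop1 : ∀ m ∈ closure Aᶜ, Φ (m, 1) 4 ≠ 0 := fun m hm =>
    hΦtop m (by have := hclA m hm; linarith)
  -- run the engine with precision `ε' = min ε ((δ - δm)/2)`
  set ε' : ℝ := min ε ((δ - δm) / 2) with hε'
  have hε'pos : 0 < ε' := lt_min hε (by linarith)
  have hε'ε : ε' ≤ ε := min_le_left _ _
  have hε'δ : ε' ≤ (δ - δm) / 2 := min_le_right _ _
  obtain ⟨ι, k, e, hemb, hdist, ⟨O', hO'o, hAO', hO'eq⟩, hcharts, hdisj, himm, hfold⟩ :=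
    engine M ι₁ hsm hinjι hinjd Φ hΦs hΦ1 hΦn A O hAc hOo hAO hOconst htop1 ε' hε'pos
  -- height bookkeeping
  have hcoord : ∀ m, |ι m 4 - ι₁ m 4| < ε' := fun m =>
    calc |ι m 4 - ι₁ m 4| = ‖(ι m - ι₁ m) 4‖ := by rw [PiLp.sub_apply, Real.norm_eq_abs]
      _ ≤ ‖ι m - ι₁ m‖ := PiLp.norm_apply_le _ 4
      _ = dist (ι m) (ι₁ m) := (dist_eq_norm _ _).symm
      _ < ε' := hdist m
  have habove : ∀ m, m ∉ A → 1 - δ < ι m 4 := by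
    intro m hm
    simp only [hA, mem_setOf_eq, not_le] at hm
    have := hcoord m
    rw [abs_lt] at this
    linarith [this.1]
  refine ⟨ι, k, e, hemb, fun m => lt_of_lt_of_le (hdist m) hε'ε, ?_, ?_, ?_, hdisj, ?_, hfold⟩
  · -- clause 3: `ι = ι₁` below the plane
    intro m hm
    exact hO'eq m (hAO' (show ι₁ m 4 ≤ 1 - δm by linarith))
  · -- clause 4: the rest stays above the plane
    intro m hm
    by_cases hmA : m ∈ A
    · rw [hO'eq m (hAO' hmA)]
      exact hm
    · exact habove m hmA
  · -- clause 5: the charts, entirely above the plane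
    intro j
    exact ⟨(hcharts j).1, fun u => habove _ ((hcharts j).2 u)⟩
  · -- clause 7: immersive shadow above the plane off the fold spheres
    intro m hm hmem
    by_cases hmA : m ∈ A
    · -- frozen part: `ι = ι₁` near `m`, and the round collar is transversal (§5)
      have hev : shadowProj ∘ ι =ᶠ[𝓝 m] shadowProj ∘ ι₁ := by
        filter_upwards [hO'o.mem_nhds (hAO' hmA)] with m' hm'
        simp [hO'eq m' hm']
      rw [hev.mfderiv_eq]
      have hm1 : ι₁ m 4 < 1 - δ₁ := by
        have : ι₁ m 4 ≤ 1 - δm := hmA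
        linarith
      have hm0 : ι₁ m 4 ≠ 0 := by
        rw [hO'eq m (hAO' hmA)] at hm
        intro h0
        rw [h0] at hm
        linarith
      exact injective_mfderiv_shadowProj_comp_of_roundPart hcont hround
        (hsm.mdifferentiableAt (by simp)) (hinjd m) hm1 hm0
    · exact himm m hmA hmem

/-- **Consistency of the engine's interface in the trivial case.**  If the starting unit normal
`Φ(·, 0)` is already nowhere horizontal off `A`, the engine's conclusion holds with `ι' = ι` and
no double folds (`k = 0`): the hypersurface is already transversal to the vertical foliation off
`A` (§4).  (A non-vacuity check of the hypothesis of `EliashbergMishachev2009_doubleFolds_of_engine`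
in the case where no wrinkling is needed.) [folklore] -/
theorem engine_conclusion_of_transversal {M : Type*} [TopologicalSpace M] [CompactSpace M]
    [ChartedSpace (𝔼 4) M] [IsManifold (𝓡 4) ∞ M] {ι : M → 𝔼 5}
    (hsm : ContMDiff (𝓡 4) (𝓡 5) ∞ ι) (hinj : Injective ι)
    (hinjd : ∀ m, Injective (mfderiv (𝓡 4) (𝓡 5) ι m)) {Φ : M × ℝ → 𝔼 5}
    (hΦn : ∀ (m : M) (v : TangentSpace (𝓡 4) m),
      ⟪Φ (m, 0), (mfderiv (𝓡 4) (𝓡 5) ι m v : 𝔼 5)⟫_ℝ = 0)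
    {A : Set M} (htr : ∀ m, m ∉ A → Φ (m, 0) 4 ≠ 0) {ε : ℝ} (hε : 0 < ε) [T2Space M] :
    ∃ (ι' : M → 𝔼 5) (k : ℕ) (e : Fin k → 𝔼 4 → M),
      Manifold.IsSmoothEmbedding (𝓡 4) (𝓡 5) ∞ ι' ∧
      (∀ m, dist (ι' m) (ι m) < ε) ∧
      (∃ O' : Set M, IsOpen O' ∧ A ⊆ O' ∧ ∀ m ∈ O', ι' m = ι m) ∧
      (∀ j, Manifold.IsSmoothEmbedding (𝓡 4) (𝓡 4) ∞ (e j) ∧ ∀ u, e j u ∉ A) ∧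
      Pairwise (Function.onFun Disjoint fun j => e j '' doubleFoldSpheres) ∧
      (∀ m, m ∉ A → m ∉ (⋃ j, e j '' doubleFoldSpheres) →
        Injective (mfderiv (𝓡 4) (𝓡 4) (shadowProj ∘ ι') m)) ∧
      (∀ j, ∀ u ∈ doubleFoldSpheres, IsWhitneyFoldAt (shadowProj ∘ ι' ∘ e j) u) := by
  refine ⟨ι, 0, Fin.elim0, ?_, fun m => by simpa using hε, ⟨Set.univ, isOpen_univ,
    Set.subset_univ _, fun _ _ => rfl⟩, fun j => j.elim0, fun j => j.elim0, ?_, fun j => j.elim0⟩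
  · exact Literature.Topology.FourManifolds.isSmoothEmbedding_of_injective_of_injective_mfderiv
      hsm (by simp) hinj hinjd
  · intro m hm _
    exact injective_mfderiv_shadowProj_comp (hsm.mdifferentiableAt (by simp)) (hinjd m) (hΦn m)
      (htr m hm)

end Engine

end Literature.Topology.Immersions
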